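import Literature.NumberTheory.Sieve.MaynardSieveTupleS2
import Literature.NumberTheory.Sieve.MaynardEquidistribution
import Literature.NumberTheory.Sieve.MaynardSmallK
import Literature.NumberTheory.Sieve.CoprimeSquarefreeSums
import Literature.NumberTheory.Sieve.LevelOfDistribution
import HarnessLib

/-!
# Maynard–Tao sieve: the main terms (Lemmas 6.2, 6.3) and the error terms (Lemma 5.2) in closed form

J. Maynard, *Small gaps between primes*, Ann. of Math. (2) 181 (2015), 383–413 = arXiv:1311.4600, §§5–6.
This file continues the fixed-`D₀` route `MaynardSieveTuples` → `MaynardSieveKernel` →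
`MaynardSieveTupleS1` (Lemma 5.1) → `MaynardSieveTupleS2` (Lemmas 5.2/5.3, combinatorial part) towards
`Literature.NumberTheory.Sieve.frequently_card_primes_ge_of_maynardFunctional_smooth` (Maynard's Proposition 4.2 for
`F = 1_{R_k} G`, `G ∈ C¹`; assembled in `MaynardSieveTupleAssembly`). It rewrites the three quantities
left open by the two predecessors —

* the diagonal `∑_A y_A²/φ(A)` of Lemma 5.1 (`abs_S1_sub_main_le`),
* the good-pair sum `∑_{good} y_A y_{A'} goodW(A, A')` of Lemmas 5.2/5.3 (`abs_mainSum2_sub_good_le`),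
* the error terms `∑' λ_d λ_e E(d, e)` of Lemma 5.2 (`S2_eq_main_add_err`),

for Maynard's choice `y_A = F(log r₁/log R, …, log r_k/log R)` (§6, "we choose `y_{r_1,…,r_k} = F(…)`")
in the shape consumed by the `k`- and `(k+1)`-dimensional equidistribution lemma
`abs_weightedSum_sub_integral_le` of `MaynardEquidistribution` (which replaces the `k` successive
applications of Lemma 6.1 = Goldston–Graham–Pintz–Yıldırım's Lemma 4 in the printed proofs of
Lemmas 6.2 and 6.3) and by the level-of-distribution hypothesis `PrimesHaveLevelPi`:

* `OneDim`: the squarefree weights `sfw W w u = μ(u)² 1_{(u,W)=1} ∏_{p∣u} w(p)` and their counting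
  function from `CoprimeSquarefreeSums` (`abs_massUpTo_sfw_sub_le`:
  `∑_{u ≤ y} sfw = (φ(W)/W)(1 + O(D₀^{-1/4})) log y + O_W(1)` when `|p w(p) − 1| ≤ C₀/p` — the `κ = 1`
  case of Lemma 6.1 for the two weights `w₁(p) = 1/(p−1)` and `w₂(p) = (p²−p−1)/(p−1)³` that occur);
* `MainTermS1`, `Coprimality`: `∑_A y_A²/φ(A) = ∑_{u pairwise coprime} (∏ sfw₁(uᵢ)) F(t(u))²`
  (`sum_sq_div_phiA_eq`, the first display of the proof of Lemma 6.2) and the removal of the pairwise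
  coprimality at relative cost `k'² C_w²/D₀` (`abs_sum_maynardBox_sub_sum_coprimeTuples_le`, proved once
  for general per-coordinate weights so that it also serves Lemma 6.3);
* `GoodPairs`, `GoodPairSum`: the good pairs `(r, s)` (equal off `m`, coprime `m`-components) are in
  bijection with pairwise coprime good `(k+1)`-tuples `(r₁, …, r_k, s_m)` subject to the two product
  constraints (`toU`/`fromU`, `sum_goodPairs_eq_sum_imgU`), whence the good-pair sum is the
  `(k+1)`-dimensional weighted sum of `Gtwo m F (t) = F(t₁..t_k) F(t₁..t_{m−1}, t_{k+1}, t_{m+1}..t_k)`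
  with weights `wvec m` (`sum_goodPairs_eq_sum_coprimeTuples`) — the sum of the proof of Lemma 6.3
  with the square of Lemma 5.3's `∑_{a_m} y/φ(a_m)` expanded into two variables (`MaynardSieveTupleS2`
  bypasses the variables `y^{(m)}`);
* `TestFunctions`, `Integrals`: `F² = 1_{R_k} G²` and `Gtwo m F = 1_{polytope (Stwo m)} (G ∘ init)(G ∘ swapT m)`
  as cut-off continuous functions on polytopes of the equidistribution lemma, continuity data
  (`exists_bound_and_modulus`, `modulus_sq`, `modulus_Gtwo`), and the identification of the integrals
  `∫_{[0,1]^k} F² = I_k(F)` (`integral_cube_sq_indicator`) and `∫_{[0,1]^{k+1}} Gtwo m F = J_k^{(m)}(F)`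
  (`integral_cube_Gtwo`, Fubini twice);
* `UpperBounds`: `∑_A 1/φ(A) ≤ M₁^k`, `∑_{good} goodW ≤ ∏ᵢ M_{wvec i}`, and `λ_max ≤ y_max M₁^{2k}`
  (`abs_lam_le_pow`; Maynard's `λ_max ≪ y_max (log R)^k` in the proof of Lemma 5.1), where
  `M_w = ∑_{v good ≤ R} sfw_w(v)`;
* `ErrTwo`, `ErrTwoBound`: with `X = π(2N + h_m − 1) − π(N + h_m − 1)` (the number of `N ≤ n < 2N` with
  `n + h_m` prime, Maynard's `X_N` up to the shift), the discrepancy `err2` of `MaynardSieveTupleS2` is a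
  difference of two values of `π(·; W q, b) − π(·)/φ(W q)` with `(b, Wq) = 1`
  (`card_filter_modEq_isPrimeAt_eq`, `abs_err2_le`: `|E(d, e)| ≤ 2 Δ_π(x; W q)`, `Δ_π` = `piDisc`, the
  summand of `PrimesHaveLevelPi`);
* `PairSum`, `Trivial`, `Assembled`: summing over pairs — at most `4^{|D|}` pairs `(d, e)` per union `D`
  and divisor tuples of weight `≤ 8^{k|D|}` per modulus `q_D` (`sum_pairs_le_sum_unions`,
  `sum_filter_qOf_eq_le`; Maynard's "at most `τ_{3k}(r)` choices"), then a threshold `T` splitting the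
  moduli into those of small multiplicity (bounded by `T ∑_{q ≤ W R²} Δ_π(x; q)`, the level of
  distribution) and those of large multiplicity (bounded by the trivial bound `Δ_π(x; M) ≤ 3x/φ(M) + 1`,
  `piDisc_le_trivial`, times `T⁻¹ 8^{k|D|}`), in place of Maynard's Cauchy–Schwarz (`sum_le_threshold`);
  the resulting sums of multiplicative weights are dominated by Euler products `≤ exp(∑_p w(p))`
  (`sum_goodNat_sfw_le_exp`, Mertens' theorem entering only through its hypothesis `hM`). The conclusion
  is `abs_pairErr_le`.

All statements are explicit inequalities at fixed `k, D₀, R, N` (no `o(1)`); the choice of the parameters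
and the limit `N → ∞` are in `MaynardSieveTupleAssembly`. Locators refer to lemma numbers and proof steps
of the published version (= arXiv v3); its display numbers are not used because the held text carries
symbolic labels only.

Parallel route (other encoding, not imported here). The tree also carries Maynard's own `o(1)` route with
`D₀ = log log log N` in the `Fin k → ℕ` encoding of `MaynardSieve.lean`/`MaynardSieveBilinear.lean`:
`MaynardSieveCounting2.lean` (the residue-class count of Lemma 5.2, counterpart of section `S2Setup` of
`MaynardSieveTupleS2` and of `ErrTwo` below), `MaynardSieveLevel.lean` (the divisor-weighted
level-of-distribution sums, counterpart of `PairSum`/`Assembled` below, via Cauchy–Schwarz as printed),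
`MaynardSieveLemma62.lean`/`MaynardSieveLemma63Sum.lean` (the evaluations (6.4)–(6.7), (6.12)–(6.14),
counterparts of `MainTermS1`/`GoodPairSum` below, via the variables `y^{(m)}` of Lemma 5.3 and the same
equidistribution lemma). The present file belongs to the fixed-`D₀` finset route justified in the header
of `MaynardSieveKernel.lean` (explicit constants at finite `N`, no `y^{(m)}`, one `(k+1)`-dimensional
equidistribution step for the good-pair sum); the two routes share only `MaynardEquidistribution` and
`CoprimeSquarefreeSums`.

## References

* J. Maynard, *Small gaps between primes*, Ann. of Math. (2) 181 (2015), 383–413,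
  doi:10.4007/annals.2015.181.1.7 = arXiv:1311.4600; Lemmas 5.1–5.3, 6.1–6.3 and their proofs,
  Proposition 4.1. [cite: MaynardAnnals2015]
* D. A. Goldston, S. W. Graham, J. Pintz, C. Y. Yıldırım, *Small gaps between products of two primes*,
  Proc. Lond. Math. Soc. 98 (2009), 741–774, Lemma 4 (= Maynard's Lemma 6.1; replaced here by
  `MaynardEquidistribution` + `CoprimeSquarefreeSums`).
-/

open Finset Real

namespace Literature.NumberTheory.Sieve
namespace MaynardTao

variable {k : ℕ}

/-! ### One-dimensional inputs from `CoprimeSquarefreeSums` -/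

section OneDim

open ArithmeticFunction

/-- The squarefree weight `u ↦ μ²(u) 1_{(u,W)=1} ∏_{p ∣ u} w(p)` with a local weight `w(p) ≈ 1/p`
(Maynard's weights `μ(u)²/φ(u)` in the proofs of Lemmas 5.1 and 6.2, and `μ(u)²/g(u)`,
`μ(r)²φ(r)/(g(r) r)` in the proofs of Lemmas 5.2 and 6.3). [cite: MaynardAnnals2015, proofs of Lemmas 6.2 and 6.3 (the sums estimated by Lemma 6.1 with κ = 1)] -/
noncomputable def sfw (W : ℕ) (w : ℕ → ℝ) (u : ℕ) : ℝ :=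
  if u ≠ 0 ∧ Squarefree u ∧ u.Coprime W then ∏ p ∈ u.primeFactors, w p else 0

/-- `sfw ≥ 0` when the local weights are nonnegative on primes. [folklore] -/
theorem sfw_nonneg {W : ℕ} {w : ℕ → ℝ} (hw : ∀ p, p.Prime → 0 ≤ w p) (u : ℕ) : 0 ≤ sfw W w u := by
  unfold sfw
  split_ifs
  · exact Finset.prod_nonneg fun p hp => hw p (Nat.prime_of_mem_primeFactors hp)
  · exact le_rfl

/-- `sfw` on its support (`u ≥ 1` squarefree, coprime to `W`). [folklore] -/
theorem sfw_apply_of {W : ℕ} (w : ℕ → ℝ) {u : ℕ} (hu : u ≠ 0) (hsq : Squarefree u) (hco : u.Coprime W) :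
    sfw W w u = ∏ p ∈ u.primeFactors, w p := by
  rw [sfw, if_pos ⟨hu, hsq, hco⟩]

/-- `sfw` vanishes off its support. [folklore] -/
theorem sfw_eq_zero_of_not {W : ℕ} (w : ℕ → ℝ) {u : ℕ} (h : ¬(u ≠ 0 ∧ Squarefree u ∧ u.Coprime W)) :
    sfw W w u = 0 := by rw [sfw, if_neg h]

/-- `sfw W w u = wfun W c u / u` with `c_p = p w(p) − 1`. [folklore] -/
theorem sfw_eq_wfun_div (W : ℕ) (w : ℕ → ℝ) (u : ℕ) :
    sfw W w u = Literature.NumberTheory.Sieve.SquarefreeSums.wfun W (fun p => (p : ℝ) * w p - 1) u / u := by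
  by_cases h : u ≠ 0 ∧ Squarefree u ∧ u.Coprime W
  · obtain ⟨hu, hsq, hco⟩ := h
    rw [sfw_apply_of w hu hsq hco, Literature.NumberTheory.Sieve.SquarefreeSums.wfun_apply_of u hu hsq hco]
    have hu' : (u : ℝ) = ∏ p ∈ u.primeFactors, (p : ℝ) := by
      rw [← Nat.cast_prod, Nat.prod_primeFactors_of_squarefree hsq]
    rw [eq_div_iff (by exact_mod_cast hu), hu', ← Finset.prod_mul_distrib]
    exact Finset.prod_congr rfl fun p _ => by ring
  · rw [sfw_eq_zero_of_not w h, Literature.NumberTheory.Sieve.SquarefreeSums.wfun_apply, if_neg h, zero_div]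

/-- The mass function of `sfw`. [folklore] -/
theorem massUpTo_sfw (W : ℕ) (w : ℕ → ℝ) (n : ℕ) :
    massUpTo (sfw W w) n = ∑ u ∈ Finset.Icc 1 n, Literature.NumberTheory.Sieve.SquarefreeSums.wfun W (fun p => (p : ℝ) * w p - 1) u / u :=
  Finset.sum_congr rfl fun u _ => sfw_eq_wfun_div W w u

/-- **Counting function of a squarefree weight** (from `Literature.NumberTheory.Sieve.SquarefreeSums.abs_sum_wfun_div_sub_le`
and `abs_bsum_sub_one_le`): if `|p w(p) − 1| ≤ C₀/p` on primes and every prime `≤ D₀` divides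
`W ≠ 0`, then for `y ≥ 1`,
`|∑_{u ≤ y} sfw(u) − (φ(W)/W) log y| ≤ ε (φ(W)/W) log y + E` with `ε = B(C₀) D₀^{-1/4}`,
`E = (harmErr W + 4) B(C₀)`. [cite: MaynardAnnals2015, Lemma 6.1 (κ = 1)] -/
theorem abs_massUpTo_sfw_sub_le {W D₀ : ℕ} (hW : W ≠ 0) (hD0 : 1 ≤ D₀)
    (hD : ∀ p, p.Prime → p ≤ D₀ → p ∣ W) {w : ℕ → ℝ} {C₀ : ℝ}
    (hc : ∀ p : ℕ, p.Prime → |(p : ℝ) * w p - 1| ≤ C₀ / p) {y : ℝ} (hy : 1 ≤ y) :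
    |massUpTo (sfw W w) ⌊y⌋₊ - (W.totient : ℝ) / W * Real.log y| ≤
      Literature.NumberTheory.Sieve.SquarefreeSums.bConst C₀ * (D₀ : ℝ) ^ (-(1:ℝ) / 4) * ((W.totient : ℝ) / W) * Real.log y +
        (Literature.NumberTheory.Sieve.SquarefreeSums.harmErr W + 4) * Literature.NumberTheory.Sieve.SquarefreeSums.bConst C₀ := by
  set c : ℕ → ℝ := fun p => (p : ℝ) * w p - 1 with hcdef
  have h1 := Literature.NumberTheory.Sieve.SquarefreeSums.abs_sum_wfun_div_sub_le (W := W) (c := c) hW hc hy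
  have h2 := Literature.NumberTheory.Sieve.SquarefreeSums.abs_bsum_sub_one_le (W := W) (c := c) hc hD0 hD hy
  rw [massUpTo_sfw]
  have hφ : 0 ≤ (W.totient : ℝ) / W := by positivity
  have hlog : 0 ≤ Real.log y := Real.log_nonneg hy
  calc |∑ u ∈ Finset.Icc 1 ⌊y⌋₊, Literature.NumberTheory.Sieve.SquarefreeSums.wfun W c u / u - (W.totient : ℝ) / W * Real.log y|
      ≤ |∑ u ∈ Finset.Icc 1 ⌊y⌋₊, Literature.NumberTheory.Sieve.SquarefreeSums.wfun W c u / u -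
            (W.totient : ℝ) / W * Literature.NumberTheory.Sieve.SquarefreeSums.bsum W c y * Real.log y| +
          |(W.totient : ℝ) / W * Literature.NumberTheory.Sieve.SquarefreeSums.bsum W c y * Real.log y - (W.totient : ℝ) / W * Real.log y| :=
        abs_sub_le _ _ _
    _ ≤ (Literature.NumberTheory.Sieve.SquarefreeSums.harmErr W + 4) * Literature.NumberTheory.Sieve.SquarefreeSums.bConst C₀ +
          (W.totient : ℝ) / W * (Literature.NumberTheory.Sieve.SquarefreeSums.bConst C₀ * (D₀ : ℝ) ^ (-(1:ℝ) / 4)) * Real.log y := by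
        refine add_le_add h1 ?_
        rw [show (W.totient : ℝ) / W * Literature.NumberTheory.Sieve.SquarefreeSums.bsum W c y * Real.log y - (W.totient : ℝ) / W * Real.log y =
          (W.totient : ℝ) / W * (Literature.NumberTheory.Sieve.SquarefreeSums.bsum W c y - 1) * Real.log y by ring, abs_mul, abs_mul,
          abs_of_nonneg hφ, abs_of_nonneg hlog]
        gcongr
    _ = _ := by ring

/-- The weight `w₁(p) = 1/(p − 1)`: `p w₁(p) − 1 = 1/(p−1)`, `|·| ≤ 2/p` (Maynard's `γ(p) = 1`,
`g(p) = γ(p)/(p − γ(p)) = 1/(p − 1)` in the proof of Lemma 6.2). [cite: MaynardAnnals2015, proof of Lemma 6.2 (choice of γ for Lemma 6.1)] -/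
theorem abs_mul_wOne_sub_one_le {p : ℕ} (hp : p.Prime) : |(p : ℝ) * wOne p - 1| ≤ 2 / p := by
  have h2 : (2:ℝ) ≤ p := by exact_mod_cast hp.two_le
  have hq : 0 < (p:ℝ) - 1 := by linarith
  rw [wOne, show (p : ℝ) * (1 / ((p : ℝ) - 1)) - 1 = 1 / ((p : ℝ) - 1) by field_simp; ring,
    abs_of_pos (by positivity), div_le_div_iff₀ hq (by linarith)]
  linarith

/-- The weight `w₂(p) = (p² − p − 1)/(p − 1)³` of the good pairs (`kernel_div_eq_goodW`):
`|p w₂(p) − 1| ≤ 16/p`, i.e. `w₂(p) = 1/p + O(1/p²)` like Maynard's `μ(r)²φ(r)/(g(r) r)` with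
`γ(p) = 1 + 1/(p² − p − 1)` in the proof of Lemma 6.3. [cite: MaynardAnnals2015, proof of Lemma 6.3 (choice of γ for Lemma 6.1)] -/
theorem abs_mul_wTwo_sub_one_le {p : ℕ} (hp : p.Prime) : |(p : ℝ) * wTwo p - 1| ≤ 16 / p := by
  have h2 : (2:ℝ) ≤ p := by exact_mod_cast hp.two_le
  have hq : 0 < (p:ℝ) - 1 := by linarith
  have hp0 : (0:ℝ) < p := by linarith
  have e : (p : ℝ) * wTwo p - 1 = (2 * (p : ℝ) ^ 2 - 4 * p + 1) / ((p : ℝ) - 1) ^ 3 := by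
    rw [wTwo]; field_simp; ring
  rw [e, abs_div, abs_of_pos (by positivity : (0:ℝ) < ((p : ℝ) - 1) ^ 3), div_le_div_iff₀ (by positivity) hp0]
  have h3 : |2 * (p : ℝ) ^ 2 - 4 * p + 1| ≤ 2 * (p : ℝ) ^ 2 := by rw [abs_le]; constructor <;> nlinarith
  have h5 : (p : ℝ) ≤ 2 * ((p : ℝ) - 1) := by linarith
  have h4 : (p : ℝ) ^ 3 ≤ 8 * ((p : ℝ) - 1) ^ 3 := by
    calc (p : ℝ) ^ 3 ≤ (2 * ((p : ℝ) - 1)) ^ 3 := by gcongr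
      _ = 8 * ((p : ℝ) - 1) ^ 3 := by ring
  calc |2 * (p : ℝ) ^ 2 - 4 * p + 1| * p ≤ 2 * (p : ℝ) ^ 2 * p := by gcongr
    _ = 2 * (p : ℝ) ^ 3 := by ring
    _ ≤ 2 * (8 * ((p : ℝ) - 1) ^ 3) := by gcongr
    _ = 16 * ((p : ℝ) - 1) ^ 3 := by ring

/-- `w₁(p) ≥ 0` on primes. [folklore] -/
theorem wOne_nonneg {p : ℕ} (hp : p.Prime) : 0 ≤ wOne p := by
  have h2 : (2:ℝ) ≤ p := by exact_mod_cast hp.two_le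
  rw [wOne]; apply div_nonneg zero_le_one; linarith

/-- `w₂(p) ≥ 0` on primes. [folklore] -/
theorem wTwo_nonneg {p : ℕ} (hp : p.Prime) : 0 ≤ wTwo p := by
  have h2 : (2:ℝ) ≤ p := by exact_mod_cast hp.two_le
  have h0 : 0 ≤ (p : ℝ) - 1 := by linarith
  rw [wTwo]; apply div_nonneg <;> nlinarith [pow_nonneg h0 3]

/-- For `W = D₀#`: an integer `u ≥ 1` is coprime to `W` iff all its prime factors exceed `D₀`.
[folklore] -/
theorem coprime_primorial_iff {D₀ u : ℕ} (hu : u ≠ 0) :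
    u.Coprime (primorial D₀) ↔ ∀ p ∈ u.primeFactors, D₀ < p := by
  constructor
  · intro h p hp
    have hpp := Nat.prime_of_mem_primeFactors hp
    by_contra hle
    push Not at hle
    have h1 : p ∣ primorial D₀ := hpp.dvd_primorial_iff.2 hle
    exact hpp.one_lt.ne' (Nat.eq_one_of_dvd_coprimes h (Nat.dvd_of_mem_primeFactors hp) h1)
  · intro h
    refine Nat.coprime_of_dvd fun p hpp hpu hpW => ?_
    have := h p (Nat.mem_primeFactors.2 ⟨hpp, hpu, hu⟩)
    rw [hpp.dvd_primorial_iff] at hpW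
    omega

/-- `goodNat D₀ R` is exactly the support of `sfw (D₀#) w` inside `[1, R]`. [folklore] -/
theorem mem_goodNat_iff {D₀ Rn u : ℕ} :
    u ∈ goodNat D₀ Rn ↔ u ∈ Finset.Icc 1 Rn ∧ Squarefree u ∧ u.Coprime (primorial D₀) := by
  rw [mem_goodNat, Finset.mem_Icc]
  constructor
  · rintro ⟨h1, h2, h3⟩; exact ⟨h1, h2, (coprime_primorial_iff (by omega)).2 h3⟩
  · rintro ⟨h1, h2, h3⟩; exact ⟨h1, h2, (coprime_primorial_iff (by omega)).1 h3⟩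

/-- On `[1, R]`, `sfw (D₀#) w` vanishes off `goodNat D₀ R`. [folklore] -/
theorem sfw_eq_zero_of_not_mem_goodNat {D₀ Rn : ℕ} (w : ℕ → ℝ) {u : ℕ} (hu : u ∈ Finset.Icc 1 Rn)
    (h : u ∉ goodNat D₀ Rn) : sfw (primorial D₀) w u = 0 := by
  refine sfw_eq_zero_of_not w fun ⟨_, hsq, hco⟩ => h (mem_goodNat_iff.2 ⟨hu, hsq, hco⟩)

/-- `sfw` on a good component of a support tuple: the product of `w` over its primes. [folklore] -/
theorem sfw_rad {D₀ Rn : ℕ} (w : ℕ → ℝ) {A : Finset (ℕ × Fin k)} (hA : A ∈ tuples k D₀ Rn) (i : Fin k) :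
    sfw (primorial D₀) w (rad A i) = ∏ x ∈ A.filter (fun x => x.2 = i), w x.1 := by
  have hmem := rad_mem_coprimeTuples hA
  rw [coprimeTuples, Finset.mem_filter, goodTuples, Fintype.mem_piFinset] at hmem
  obtain ⟨h1, hsq, hco⟩ := mem_goodNat_iff.1 (hmem.1 i)
  rw [sfw_apply_of w (by have := (Finset.mem_Icc.1 h1).1; omega) hsq hco,
    primeFactors_rad (isFunctional_of_mem_tuples hA) (fun x hx => prime_of_mem_tuples hA hx) i,
    Finset.prod_image]
  exact fun x hx y hy hxy => (isFunctional_of_mem_tuples hA) x (Finset.mem_filter.1 hx).1 y (Finset.mem_filter.1 hy).1 hxy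

end OneDim

/-! ### Main term of `S₁`: from support tuples to the weighted sum over integer tuples -/

section MainTermS1

variable {D₀ Rn : ℕ} {R : ℝ}

/-- For a tuple with `∏ rᵢ > R`, the logarithmic position lies outside the simplex. [folklore] -/
theorem indicator_logPos_eq_zero_of_not_mem_tuplesProd (hR : 1 < R) (hRn : Rn = ⌊R⌋₊)
    (Gf : (Fin k → ℝ) → ℝ) {A : Finset (ℕ × Fin k)} (hA : A ∈ tuples k D₀ Rn) (hA' : A ∉ tuplesProd k D₀ Rn) :
    (maynardSimplex k).indicator Gf (logPos R (rad A)) = 0 := by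
  refine Set.indicator_of_notMem (fun hmem => hA' ?_) _
  rw [mem_tuplesProd]
  refine ⟨hA, ?_⟩
  have hsum := hmem.2
  have hlogR : 0 < Real.log R := Real.log_pos hR
  have hp : ∀ x ∈ A, x.1.Prime := fun x hx => prime_of_mem_tuples hA hx
  simp only [logPos] at hsum
  rw [← Finset.sum_div, div_le_one hlogR, ← Real.log_prod (s := Finset.univ) (f := fun i => ((rad A i : ℕ) : ℝ))
    (fun i _ => by exact_mod_cast (rad_pos hp i).ne')] at hsum
  have hprod : ((∏ i, rad A i : ℕ) : ℝ) ≤ R := by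
    have h0 : (0:ℝ) < ∏ i, (rad A i : ℝ) := Finset.prod_pos fun i _ => by exact_mod_cast rad_pos hp i
    have := (Real.log_le_log_iff h0 (by linarith)).1 hsum
    push_cast; exact this
  rw [prod_rad] at hprod
  rw [hRn]
  exact Nat.le_floor hprod

/-- `1/φ(A) = ∏ᵢ sfw₁(rᵢ)` for a support tuple. [folklore] -/
theorem one_div_phiA_eq_prod_sfw {A : Finset (ℕ × Fin k)} (hA : A ∈ tuples k D₀ Rn) :
    1 / phiA A = ∏ i, sfw (primorial D₀) wOne (rad A i) := by
  simp_rw [sfw_rad wOne hA]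
  rw [Finset.prod_fiberwise A Prod.snd (fun x => wOne x.1), phiA, one_div, ← Finset.prod_inv_distrib]
  exact Finset.prod_congr rfl fun x _ => by rw [wOne, one_div]

/-- **The diagonal of Lemma 5.1 as a sum over pairwise coprime integer tuples** (the first display of
the proof of Lemma 6.2: `S₁ = (N/W) ∑_{u: (uᵢ,uⱼ)=1, (uᵢ,W)=1} (∏ μ(uᵢ)²/φ(uᵢ)) F(log u₁/log R, …)² + …`):
`∑_A y_A²/φ(A) = ∑_{u pairwise coprime, good} (∏ᵢ sfw₁(uᵢ)) F(log u/log R)²` for `y_A = F(t_A)`,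
`F = 1_{R_k} G`. [cite: MaynardAnnals2015, proof of Lemma 6.2 (substitution of the choice of y into Lemma 5.1)] -/
theorem sum_sq_div_phiA_eq (hR : 1 < R) (hRn : Rn = ⌊R⌋₊) (Gf : (Fin k → ℝ) → ℝ) :
    ∑ A ∈ tuplesProd k D₀ Rn, ((maynardSimplex k).indicator Gf (logPos R (rad A))) ^ 2 / phiA A =
      ∑ u ∈ coprimeTuples k D₀ Rn, (∏ i, sfw (primorial D₀) wOne (u i)) *
        ((maynardSimplex k).indicator Gf (logPos R u)) ^ 2 := by
  rw [Finset.sum_subset tuplesProd_subset fun A hA hA' => by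
    rw [indicator_logPos_eq_zero_of_not_mem_tuplesProd hR hRn Gf hA hA']; simp]
  rw [Finset.sum_congr rfl fun A hA => show ((maynardSimplex k).indicator Gf (logPos R (rad A))) ^ 2 / phiA A =
      (∏ i, sfw (primorial D₀) wOne (rad A i)) * ((maynardSimplex k).indicator Gf (logPos R (rad A))) ^ 2 by
    rw [div_eq_mul_one_div, one_div_phiA_eq_prod_sfw hA, mul_comm]]
  exact sum_tuples_eq_sum_coprimeTuples
    (fun u => (∏ i, sfw (primorial D₀) wOne (u i)) * ((maynardSimplex k).indicator Gf (logPos R u)) ^ 2)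

end MainTermS1

/-! ### Dropping the pairwise coprimality of integer tuples (proof of Lemma 6.2) -/

section Coprimality

variable {k' D₀ Rn : ℕ} {R : ℝ}

/-- Sums over a `biUnion` are at most the sums of the sums (nonnegative summands). [folklore] -/
theorem sum_biUnion_le_sum_sum {ι β : Type*} [DecidableEq β] (s : Finset ι) (t : ι → Finset β)
    (f : β → ℝ) (hf : ∀ b, 0 ≤ f b) : ∑ b ∈ s.biUnion t, f b ≤ ∑ a ∈ s, ∑ b ∈ t a, f b := by
  classical
  induction s using Finset.induction_on with
  | empty => simp
  | insert a s ha ih =>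
    rw [Finset.biUnion_insert, Finset.sum_insert ha]
    have h1 := Finset.sum_union_inter (s₁ := t a) (s₂ := s.biUnion t) (f := f)
    have h2 : 0 ≤ ∑ b ∈ t a ∩ s.biUnion t, f b := Finset.sum_nonneg fun b _ => hf b
    linarith

/-- **Multiples of `p` weigh `w(p)` times the rest**: for a prime `p ∤ D₀#`,
`∑_{v good, p ∣ v} sfw(v) ≤ w(p) ∑_{v good} sfw(v)` (the step `∑_{p ∣ uᵢ, p ∣ uⱼ} ≪ (1/(p−1)²)(∑_u)`
of the removal of the condition `(uᵢ, uⱼ) = 1` in the proof of Lemma 6.2). [cite: MaynardAnnals2015, proof of Lemma 6.2 (removal of the condition (u_i, u_j) = 1)] -/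
theorem sum_filter_dvd_sfw_le {w : ℕ → ℝ} (hw : ∀ p, p.Prime → 0 ≤ w p) {p : ℕ} (hp : p.Prime) :
    ∑ v ∈ (goodNat D₀ Rn).filter (fun v => p ∣ v), sfw (primorial D₀) w v ≤
      w p * ∑ v ∈ goodNat D₀ Rn, sfw (primorial D₀) w v := by
  have hterm : ∀ v ∈ (goodNat D₀ Rn).filter (fun v => p ∣ v),
      sfw (primorial D₀) w v = w p * sfw (primorial D₀) w (v / p) ∧ v / p ∈ goodNat D₀ Rn := by
    intro v hv
    obtain ⟨hv, hpv⟩ := Finset.mem_filter.1 hv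
    obtain ⟨h1, hsq, hco⟩ := mem_goodNat_iff.1 hv
    have hv0 : v ≠ 0 := by have := (Finset.mem_Icc.1 h1).1; omega
    obtain ⟨m, rfl⟩ := hpv
    have hm0 : m ≠ 0 := fun h => hv0 (by rw [h, mul_zero])
    have hpm : ¬p ∣ m := fun h => by
      have : p * p ∣ p * m := mul_dvd_mul_left p h
      exact hp.one_lt.ne' (Nat.isUnit_iff.1 (hsq p this))
    have hcop : Nat.Coprime p m := (Nat.Prime.coprime_iff_not_dvd hp).2 hpm
    have hdiv : p * m / p = m := Nat.mul_div_cancel_left m hp.pos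
    rw [hdiv]
    have hsqm : Squarefree m := hsq.squarefree_of_dvd (dvd_mul_left m p)
    have hcom : m.Coprime (primorial D₀) := Nat.Coprime.coprime_dvd_left (dvd_mul_left m p) hco
    refine ⟨?_, mem_goodNat_iff.2 ⟨Finset.mem_Icc.2 ⟨Nat.pos_of_ne_zero hm0, le_trans (Nat.le_mul_of_pos_left m hp.pos)
      (Finset.mem_Icc.1 h1).2⟩, hsqm, hcom⟩⟩
    rw [sfw_apply_of w hv0 hsq hco, sfw_apply_of w hm0 hsqm hcom, Nat.primeFactors_mul hp.ne_zero hm0,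
      hp.primeFactors, Finset.prod_union, Finset.prod_singleton]
    rw [Finset.disjoint_singleton_left]
    exact fun h => hpm (Nat.dvd_of_mem_primeFactors h)
  calc ∑ v ∈ (goodNat D₀ Rn).filter (fun v => p ∣ v), sfw (primorial D₀) w v
      = ∑ v ∈ (goodNat D₀ Rn).filter (fun v => p ∣ v), w p * sfw (primorial D₀) w (v / p) :=
        Finset.sum_congr rfl fun v hv => (hterm v hv).1
    _ = w p * ∑ m ∈ ((goodNat D₀ Rn).filter (fun v => p ∣ v)).image (fun v => v / p), sfw (primorial D₀) w m := by
        rw [Finset.mul_sum, Finset.sum_image]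
        intro v hv v' hv' h
        have hpv := (Finset.mem_filter.1 hv).2
        have hpv' := (Finset.mem_filter.1 hv').2
        dsimp only at h
        rw [← Nat.div_mul_cancel hpv, ← Nat.div_mul_cancel hpv', h]
    _ ≤ w p * ∑ m ∈ goodNat D₀ Rn, sfw (primorial D₀) w m := by
        refine mul_le_mul_of_nonneg_left ?_ (hw p hp)
        refine Finset.sum_le_sum_of_subset_of_nonneg (fun m hm => ?_) fun m _ _ => sfw_nonneg hw m
        obtain ⟨v, hv, rfl⟩ := Finset.mem_image.1 hm
        exact (hterm v hv).2

/-- **Dropping pairwise coprimality** (Maynard 2015, proof of Lemma 6.2: "we can drop the requirement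
that `(u_i, u_j) = 1`, at the cost of an error of size `≪ F_max² … /D₀`"; likewise in the proof of
Lemma 6.3): for per-coordinate squarefree
weights `sfw (wv i)` with `0 ≤ wv i p ≤ Cw/p` on primes and a bounded test function `|Φ| ≤ Y`,
`|∑_{u ∈ [1,R]^{k'}} (∏ sfw) Φ − ∑_{u pairwise coprime good} (∏ sfw) Φ| ≤ Y k'² Cw²/D₀ ∏ᵢ Mᵢ`,
`Mᵢ = ∑_{v good} sfwᵢ(v)`. [cite: MaynardAnnals2015, proofs of Lemmas 6.2 and 6.3 (removal of the condition (u_i, u_j) = 1)] -/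
theorem abs_sum_maynardBox_sub_sum_coprimeTuples_le (hRn : Rn = ⌊R⌋₊) (hD0 : 0 < D₀)
    {wv : Fin k' → ℕ → ℝ} {Cw : ℝ} (hw0 : ∀ i p, p.Prime → 0 ≤ wv i p) (hwC : ∀ i p, p.Prime → wv i p ≤ Cw / p)
    {Φ : (Fin k' → ℕ) → ℝ} {Y : ℝ} (hY0 : 0 ≤ Y) (hΦ : ∀ u, |Φ u| ≤ Y) :
    |∑ u ∈ maynardBox k' R, (∏ i, sfw (primorial D₀) (wv i) (u i)) * Φ u -
        ∑ u ∈ coprimeTuples k' D₀ Rn, (∏ i, sfw (primorial D₀) (wv i) (u i)) * Φ u| ≤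
      Y * ((k' : ℝ) ^ 2 * Cw ^ 2 / D₀) * ∏ i, ∑ v ∈ goodNat D₀ Rn, sfw (primorial D₀) (wv i) v := by
  classical
  set W := primorial D₀ with hW
  set wt : Fin k' → ℕ → ℝ := fun i => sfw W (wv i) with hwt
  have hwt0 : ∀ i u, 0 ≤ wt i u := fun i u => sfw_nonneg (hw0 i) u
  have hM0 : ∀ i, 0 ≤ ∑ v ∈ goodNat D₀ Rn, wt i v := fun i => Finset.sum_nonneg fun v _ => hwt0 i v
  -- Step 1: restrict the box sum to good tuples
  have hgood_sub : goodTuples k' D₀ Rn ⊆ maynardBox k' R := by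
    intro u hu
    rw [maynardBox, Fintype.mem_piFinset]; intro i
    rw [← hRn]; exact (mem_goodNat_iff.1 (Fintype.mem_piFinset.1 hu i)).1
  have step1 : ∑ u ∈ maynardBox k' R, (∏ i, wt i (u i)) * Φ u = ∑ u ∈ goodTuples k' D₀ Rn, (∏ i, wt i (u i)) * Φ u := by
    symm
    refine Finset.sum_subset hgood_sub fun u hu hu' => ?_
    rw [goodTuples, Fintype.mem_piFinset] at hu'
    push Not at hu'
    obtain ⟨i, hi⟩ := hu'
    have hui : u i ∈ Finset.Icc 1 Rn := by rw [hRn]; exact Fintype.mem_piFinset.1 hu i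
    rw [Finset.prod_eq_zero (Finset.mem_univ i) (sfw_eq_zero_of_not_mem_goodNat (wv i) hui hi), zero_mul]
  -- Step 2: good = coprime ⊔ bad
  set bad := (goodTuples k' D₀ Rn).filter (fun u => ¬∀ i j, i ≠ j → (u i).Coprime (u j)) with hbad
  have step2 : ∑ u ∈ goodTuples k' D₀ Rn, (∏ i, wt i (u i)) * Φ u =
      ∑ u ∈ coprimeTuples k' D₀ Rn, (∏ i, wt i (u i)) * Φ u + ∑ u ∈ bad, (∏ i, wt i (u i)) * Φ u := by
    rw [coprimeTuples, hbad]; exact (Finset.sum_filter_add_sum_filter_not _ _ _).symm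
  rw [step1, step2, add_sub_cancel_left]
  -- Step 3: bad tuples are covered by `{p | u i, p | u j}` over primes `p ∈ (D₀, R]` and `i ≠ j`
  set fib : ℕ × Fin k' × Fin k' → Finset (Fin k' → ℕ) := fun κ =>
    (goodTuples k' D₀ Rn).filter (fun u => κ.1 ∣ u κ.2.1 ∧ κ.1 ∣ u κ.2.2) with hfib
  set Kset := primesIoc D₀ Rn ×ˢ ((Finset.univ : Finset (Fin k')) ×ˢ (Finset.univ : Finset (Fin k'))).filter
    (fun ij => ij.1 ≠ ij.2) with hKset
  have hcover : bad ⊆ Kset.biUnion fib := by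
    intro u hu
    rw [hbad, Finset.mem_filter] at hu
    obtain ⟨hug, hnc⟩ := hu
    push Not at hnc
    obtain ⟨i, j, hij, hncop⟩ := hnc
    obtain ⟨p, hp, hpi, hpj⟩ := Nat.Prime.not_coprime_iff_dvd.1 hncop
    have hui := mem_goodNat_iff.1 (Fintype.mem_piFinset.1 hug i)
    have hui0 : u i ≠ 0 := by have := (Finset.mem_Icc.1 hui.1).1; omega
    have hpD : D₀ < p := (coprime_primorial_iff hui0).1 hui.2.2 p (Nat.mem_primeFactors.2 ⟨hp, hpi, hui0⟩)
    have hpR : p ≤ Rn := (Nat.le_of_dvd (Nat.pos_of_ne_zero hui0) hpi).trans (Finset.mem_Icc.1 hui.1).2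
    rw [Finset.mem_biUnion]
    refine ⟨(p, i, j), ?_, ?_⟩
    · rw [hKset, Finset.mem_product, mem_primesIoc, Finset.mem_filter]
      exact ⟨⟨⟨hpD, hpR⟩, hp⟩, Finset.mem_product.2 ⟨Finset.mem_univ _, Finset.mem_univ _⟩, hij⟩
    · rw [hfib, Finset.mem_filter]; exact ⟨hug, hpi, hpj⟩
  -- Step 4: each fibre has product structure and small mass
  have hfibre : ∀ κ ∈ Kset, ∑ u ∈ fib κ, ∏ i, wt i (u i) ≤ (Cw / κ.1) ^ 2 * ∏ i, ∑ v ∈ goodNat D₀ Rn, wt i v := by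
    rintro ⟨p, i, j⟩ hκ
    rw [hKset, Finset.mem_product, mem_primesIoc, Finset.mem_filter] at hκ
    obtain ⟨⟨⟨hpD, _⟩, hp⟩, _, hij⟩ := hκ
    simp only at hij
    have hset : fib (p, i, j) = Fintype.piFinset fun l => if l = i ∨ l = j then (goodNat D₀ Rn).filter (fun v => p ∣ v)
        else goodNat D₀ Rn := by
      ext u
      rw [hfib, Finset.mem_filter, goodTuples, Fintype.mem_piFinset, Fintype.mem_piFinset]
      constructor
      · rintro ⟨hu, h1, h2⟩ l
        split_ifs with hl
        · rcases hl with rfl | rfl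
          · exact Finset.mem_filter.2 ⟨hu _, h1⟩
          · exact Finset.mem_filter.2 ⟨hu _, h2⟩
        · exact hu l
      · intro hu
        refine ⟨fun l => ?_, ?_, ?_⟩
        · have := hu l
          split_ifs at this
          · exact (Finset.mem_filter.1 this).1
          · exact this
        · have := hu i; rw [if_pos (Or.inl rfl)] at this; exact (Finset.mem_filter.1 this).2
        · have := hu j; rw [if_pos (Or.inr rfl)] at this; exact (Finset.mem_filter.1 this).2
    rw [hset, ← Finset.prod_univ_sum]
    -- compare factor by factor
    have hfac : ∀ l, ∑ v ∈ (if l = i ∨ l = j then (goodNat D₀ Rn).filter (fun v => p ∣ v) else goodNat D₀ Rn), wt l v ≤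
        (if l = i ∨ l = j then wv l p else 1) * ∑ v ∈ goodNat D₀ Rn, wt l v := by
      intro l
      split_ifs
      · exact sum_filter_dvd_sfw_le (hw0 l) hp
      · rw [one_mul]
    calc ∏ l, ∑ v ∈ (if l = i ∨ l = j then (goodNat D₀ Rn).filter (fun v => p ∣ v) else goodNat D₀ Rn), wt l v
        ≤ ∏ l, ((if l = i ∨ l = j then wv l p else 1) * ∑ v ∈ goodNat D₀ Rn, wt l v) :=
          Finset.prod_le_prod (fun l _ => Finset.sum_nonneg fun v _ => hwt0 l v) fun l _ => hfac l
      _ = (∏ l, (if l = i ∨ l = j then wv l p else 1)) * ∏ l, ∑ v ∈ goodNat D₀ Rn, wt l v := Finset.prod_mul_distrib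
      _ ≤ (Cw / p) ^ 2 * ∏ l, ∑ v ∈ goodNat D₀ Rn, wt l v := by
          refine mul_le_mul_of_nonneg_right ?_ (Finset.prod_nonneg fun l _ => hM0 l)
          rw [Finset.prod_ite, Finset.prod_const_one, mul_one]
          have hcard : ((Finset.univ : Finset (Fin k')).filter (fun l => l = i ∨ l = j)) = {i, j} := by
            ext l; simp
          rw [hcard, Finset.prod_pair hij, sq]
          have hCw : 0 ≤ Cw / p := le_trans (hw0 i p hp) (hwC i p hp)
          exact mul_le_mul (hwC i p hp) (hwC j p hp) (hw0 j p hp) hCw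
  -- Step 5: sum over the keys
  have hD0' : (0:ℝ) < D₀ := by exact_mod_cast hD0
  calc |∑ u ∈ bad, (∏ i, wt i (u i)) * Φ u| ≤ ∑ u ∈ bad, |(∏ i, wt i (u i)) * Φ u| := Finset.abs_sum_le_sum_abs _ _
    _ ≤ ∑ u ∈ bad, Y * ∏ i, wt i (u i) := by
        refine Finset.sum_le_sum fun u _ => ?_
        rw [abs_mul, abs_of_nonneg (Finset.prod_nonneg fun i _ => hwt0 i (u i)), mul_comm]
        exact mul_le_mul_of_nonneg_right (hΦ u) (Finset.prod_nonneg fun i _ => hwt0 i (u i))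
    _ = Y * ∑ u ∈ bad, ∏ i, wt i (u i) := by rw [Finset.mul_sum]
    _ ≤ Y * ∑ u ∈ Kset.biUnion fib, ∏ i, wt i (u i) :=
        mul_le_mul_of_nonneg_left (Finset.sum_le_sum_of_subset_of_nonneg hcover
          fun u _ _ => Finset.prod_nonneg fun i _ => hwt0 i (u i)) hY0
    _ ≤ Y * ∑ κ ∈ Kset, ∑ u ∈ fib κ, ∏ i, wt i (u i) :=
        mul_le_mul_of_nonneg_left (sum_biUnion_le_sum_sum Kset fib _ fun u => Finset.prod_nonneg fun i _ => hwt0 i (u i)) hY0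
    _ ≤ Y * ∑ κ ∈ Kset, (Cw / κ.1) ^ 2 * ∏ i, ∑ v ∈ goodNat D₀ Rn, wt i v :=
        mul_le_mul_of_nonneg_left (Finset.sum_le_sum hfibre) hY0
    _ = Y * ((∑ κ ∈ Kset, (Cw / κ.1) ^ 2) * ∏ i, ∑ v ∈ goodNat D₀ Rn, wt i v) := by rw [Finset.sum_mul]
    _ ≤ Y * (((k' : ℝ) ^ 2 * Cw ^ 2 / D₀) * ∏ i, ∑ v ∈ goodNat D₀ Rn, wt i v) := by
        gcongr
        · exact Finset.prod_nonneg fun i _ => hM0 i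
        · -- `∑_{p, i ≠ j} (Cw/p)² ≤ k'² Cw² ∑_{p > D₀} 1/p² ≤ k'² Cw²/D₀`
          rw [hKset, Finset.sum_product]
          calc ∑ p ∈ primesIoc D₀ Rn, ∑ ij ∈ ((Finset.univ : Finset (Fin k')) ×ˢ (Finset.univ : Finset (Fin k'))).filter
                (fun ij => ij.1 ≠ ij.2), (Cw / ((p, ij).1 : ℕ)) ^ 2
              = ∑ p ∈ primesIoc D₀ Rn, ((((Finset.univ : Finset (Fin k')) ×ˢ (Finset.univ : Finset (Fin k'))).filter
                  (fun ij => ij.1 ≠ ij.2)).card : ℝ) * (Cw / p) ^ 2 := by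
                refine Finset.sum_congr rfl fun p _ => ?_
                simp only [Finset.sum_const, nsmul_eq_mul]
            _ ≤ ∑ p ∈ primesIoc D₀ Rn, (k' : ℝ) ^ 2 * (Cw ^ 2 * (1 / (p : ℝ) ^ 2)) := by
                refine Finset.sum_le_sum fun p hp => ?_
                rw [div_pow, show Cw ^ 2 / (p : ℝ) ^ 2 = Cw ^ 2 * (1 / (p : ℝ) ^ 2) by ring]
                refine mul_le_mul_of_nonneg_right ?_ (by positivity)
                have : ((((Finset.univ : Finset (Fin k')) ×ˢ (Finset.univ : Finset (Fin k'))).filter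
                    (fun ij => ij.1 ≠ ij.2)).card : ℝ) ≤ ((Finset.univ : Finset (Fin k')) ×ˢ (Finset.univ : Finset (Fin k'))).card := by
                  exact_mod_cast Finset.card_le_card (Finset.filter_subset _ _)
                rw [Finset.card_product, Finset.card_univ, Fintype.card_fin] at this
                push_cast at this
                nlinarith
            _ = (k' : ℝ) ^ 2 * Cw ^ 2 * ∑ p ∈ primesIoc D₀ Rn, 1 / (p : ℝ) ^ 2 := by
                rw [Finset.mul_sum]; exact Finset.sum_congr rfl fun p _ => by ring
            _ ≤ (k' : ℝ) ^ 2 * Cw ^ 2 * (1 / (D₀ : ℝ)) := by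
                gcongr
                calc ∑ p ∈ primesIoc D₀ Rn, 1 / (p : ℝ) ^ 2 ≤ ∑ n ∈ Finset.Ioc D₀ Rn, 1 / (n : ℝ) ^ 2 :=
                      Finset.sum_le_sum_of_subset_of_nonneg (Finset.filter_subset _ _) fun n _ _ => by positivity
                  _ ≤ 1 / (D₀ : ℝ) := sum_Ioc_one_div_sq_le hD0 Rn
            _ = (k' : ℝ) ^ 2 * Cw ^ 2 / D₀ := by ring
    _ = _ := by ring

end Coprimality

/-! ### Good pairs of `S₂^{(m)}` as `(k+1)`-tuples of integers -/

section GoodPairs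

variable {D₀ Rn : ℕ} (m : Fin k)

/-- The `(k+1)`-tuple `(r_1, …, r_k, s_m)` of a good pair `(r, s)` (equal off `m`): the summation
variables `r_1, …, r_{m−1}, r_{m+1}, …, r_k` and the two copies `a_m`, `a'_m` of the free variable of
Lemma 5.3 in the square `(y^{(m)}_r)²` of the proof of Lemma 6.3. [cite: MaynardAnnals2015, proof of Lemma 6.3 (substitution of Lemma 5.3 into Lemma 5.2)] -/
noncomputable def toU (P : Finset (ℕ × Fin k) × Finset (ℕ × Fin k)) : Fin (k + 1) → ℕ :=
  Fin.snoc (rad P.1) (rad P.2 m)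

/-- The pair reconstructed from a `(k+1)`-tuple: `r = (u_1,…,u_k)`, `s = r` off `m`, `s_m = u_{k+1}`.
[folklore] -/
noncomputable def fromU (u : Fin (k + 1) → ℕ) : Finset (ℕ × Fin k) × Finset (ℕ × Fin k) :=
  (ofNat (Fin.init u), offPart (ofNat (Fin.init u)) m ∪ (u (Fin.last k)).primeFactors ×ˢ {m})

/-- The image: pairwise coprime good `(k+1)`-tuples with `∏_{i ≤ k} uᵢ ≤ R` and
`(∏_{i ≤ k, i ≠ m} uᵢ) u_{k+1} ≤ R`. [folklore] -/
noncomputable def imgU (k D₀ Rn : ℕ) (m : Fin k) : Finset (Fin (k + 1) → ℕ) :=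
  (coprimeTuples (k + 1) D₀ Rn).filter (fun u => ∏ j : Fin k, u j.castSucc ≤ Rn ∧
    (∏ j ∈ (Finset.univ : Finset (Fin k)).erase m, u j.castSucc) * u (Fin.last k) ≤ Rn)

/-- The good pairs (equal off-parts, disjoint `m`-parts). [folklore] -/
noncomputable def goodPairs (k D₀ Rn : ℕ) (m : Fin k) : Finset (Finset (ℕ × Fin k) × Finset (ℕ × Fin k)) :=
  (tuplesProd k D₀ Rn ×ˢ tuplesProd k D₀ Rn).filter (fun P => ¬BadPair m P)

variable {m}

/-- Membership in `goodPairs`: two support tuples of level `R` with equal off-parts and disjoint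
`m`-parts (`not_badPair_iff`). [folklore] -/
theorem mem_goodPairs {P : Finset (ℕ × Fin k) × Finset (ℕ × Fin k)} :
    P ∈ goodPairs k D₀ Rn m ↔ P.1 ∈ tuplesProd k D₀ Rn ∧ P.2 ∈ tuplesProd k D₀ Rn ∧
      offPart P.1 m = offPart P.2 m ∧ Disjoint ((mPart P.1 m).image Prod.fst) ((mPart P.2 m).image Prod.fst) := by
  rw [goodPairs, Finset.mem_filter, Finset.mem_product]
  constructor
  · rintro ⟨⟨h1, h2⟩, hg⟩; exact ⟨h1, h2, (not_badPair_iff m h1 h2).1 hg⟩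
  · rintro ⟨h1, h2, hg⟩; exact ⟨⟨h1, h2⟩, (not_badPair_iff m h1 h2).2 hg⟩

/-- `∏_{x ∈ A∖m} p = ∏_{j ≠ m} r_j`. [folklore] -/
theorem prod_offPart_eq (A : Finset (ℕ × Fin k)) (m : Fin k) :
    ∏ x ∈ offPart A m, x.1 = ∏ j ∈ (Finset.univ : Finset (Fin k)).erase m, rad A j := by
  rw [offPart, ← Finset.prod_fiberwise_of_maps_to (g := Prod.snd) (t := (Finset.univ : Finset (Fin k)).erase m)
    (fun x hx => Finset.mem_erase.2 ⟨(Finset.mem_filter.1 hx).2, Finset.mem_univ _⟩)]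
  refine Finset.prod_congr rfl fun j hj => ?_
  rw [rad, Finset.filter_filter]
  exact Finset.prod_congr (Finset.filter_congr fun x _ => ⟨fun h => h.2, fun h => ⟨h ▸ Finset.ne_of_mem_erase hj, h⟩⟩)
    fun _ _ => rfl

/-- The `m`-part of a support tuple consists of the primes of `r_m`, tagged `m`. [folklore] -/
theorem mPart_eq_primeFactors_product {A : Finset (ℕ × Fin k)} (hA : A ∈ tuples k D₀ Rn) (m : Fin k) :
    mPart A m = (rad A m).primeFactors ×ˢ {m} := by
  ext ⟨p, i⟩
  rw [mem_mPart, Finset.mem_product, Finset.mem_singleton,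
    mem_rad_primeFactors (isFunctional_of_mem_tuples hA) (fun x hx => prime_of_mem_tuples hA hx)]
  constructor
  · rintro ⟨h, rfl⟩; exact ⟨h, rfl⟩
  · rintro ⟨h, rfl⟩; exact ⟨h, rfl⟩

/-- Equal off-parts give equal components `r_j = r'_j` for every `j ≠ m`. [folklore] -/
theorem rad_eq_of_offPart_eq {A A' : Finset (ℕ × Fin k)} {m : Fin k} (h : offPart A m = offPart A' m) {j : Fin k}
    (hj : j ≠ m) : rad A j = rad A' j := by
  have key : ∀ B : Finset (ℕ × Fin k), B.filter (fun x => x.2 = j) = (offPart B m).filter (fun x => x.2 = j) := by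
    intro B
    rw [offPart, Finset.filter_filter]
    exact Finset.filter_congr fun x _ => ⟨fun hx => ⟨hx ▸ hj, hx⟩, fun hx => hx.2⟩
  rw [rad, rad, key A, key A', h]

/-- The first `k` coordinates of `toU P` are the components `rⱼ` of `P.1`. [folklore] -/
theorem toU_castSucc (P : Finset (ℕ × Fin k) × Finset (ℕ × Fin k)) (j : Fin k) :
    toU m P j.castSucc = rad P.1 j := by
  rw [toU, Fin.snoc_castSucc]

/-- The last coordinate of `toU P` is the `m`-component `s_m` of `P.2`. [folklore] -/
theorem toU_last (P : Finset (ℕ × Fin k) × Finset (ℕ × Fin k)) : toU m P (Fin.last k) = rad P.2 m := by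
  rw [toU, Fin.snoc_last]

/-- `Fin.init (toU P) = r`. [folklore] -/
theorem init_toU (P : Finset (ℕ × Fin k) × Finset (ℕ × Fin k)) : Fin.init (toU m P) = rad P.1 := by
  rw [toU, Fin.init_snoc]

section fwd

variable {P : Finset (ℕ × Fin k) × Finset (ℕ × Fin k)} (hP : P ∈ goodPairs k D₀ Rn m)
include hP

/-- `toU` maps the good pairs into `imgU`: the `(k+1)`-tuple is good and pairwise coprime (within
`r`; and `s_m` against `r_j`, for `j ≠ m` because `s` is a support tuple with `s_j = r_j`, for `j = m` by
the disjointness of the `m`-parts), with `∏ⱼ rⱼ ≤ R` and `(∏_{j ≠ m} r_j) s_m = ∏ⱼ sⱼ ≤ R`. [folklore] -/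
theorem toU_mem_imgU : toU m P ∈ imgU k D₀ Rn m := by
  obtain ⟨h1, h2, hoff, hdisj⟩ := mem_goodPairs.1 hP
  have h1' := tuplesProd_subset h1
  have h2' := tuplesProd_subset h2
  have hf1 := isFunctional_of_mem_tuples h1'
  have hf2 := isFunctional_of_mem_tuples h2'
  have hp1 : ∀ x ∈ P.1, x.1.Prime := fun x hx => prime_of_mem_tuples h1' hx
  have hp2 : ∀ x ∈ P.2, x.1.Prime := fun x hx => prime_of_mem_tuples h2' hx
  have hc1 := rad_mem_coprimeTuples h1'
  have hc2 := rad_mem_coprimeTuples h2'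
  rw [coprimeTuples, Finset.mem_filter, goodTuples, Fintype.mem_piFinset] at hc1 hc2
  rw [imgU, Finset.mem_filter, coprimeTuples, Finset.mem_filter, goodTuples, Fintype.mem_piFinset]
  refine ⟨⟨fun i => ?_, fun i j hij => ?_⟩, ?_, ?_⟩
  · refine Fin.lastCases ?_ (fun j => ?_) i
    · rw [toU_last (m := m) P]; exact hc2.1 m
    · rw [toU_castSucc (m := m) P]; exact hc1.1 j
  · -- pairwise coprimality: within `r`, and between `s_m` and each `r_j`
    have cross : ∀ j : Fin k, (rad P.1 j).Coprime (rad P.2 m) := by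
      intro j
      by_cases hjm : j = m
      · subst hjm
        rw [← Nat.disjoint_primeFactors (rad_ne_zero hp1 _) (rad_ne_zero hp2 _),
          primeFactors_rad hf1 hp1, primeFactors_rad hf2 hp2]
        exact hdisj
      · rw [rad_eq_of_offPart_eq hoff hjm]; exact hc2.2 j m hjm
    induction i using Fin.lastCases with
    | last =>
      induction j using Fin.lastCases with
      | last => exact absurd rfl hij
      | cast j => rw [toU_last (m := m) P, toU_castSucc (m := m) P]; exact (cross j).symm
    | cast i =>
      induction j using Fin.lastCases with
      | last => rw [toU_last (m := m) P, toU_castSucc (m := m) P]; exact cross i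
      | cast j =>
        rw [toU_castSucc (m := m) P, toU_castSucc (m := m) P]
        exact hc1.2 i j fun h => hij (by rw [h])
  · simp_rw [toU_castSucc (m := m) P]
    rw [prod_rad]; exact (mem_tuplesProd.1 h1).2
  · simp_rw [toU_castSucc (m := m) P]
    rw [toU_last (m := m) P, ← prod_offPart_eq, hoff, prod_offPart_eq,
      Finset.prod_erase_mul _ _ (Finset.mem_univ m), prod_rad]
    exact (mem_tuplesProd.1 h2).2

/-- `fromU ∘ toU = id` on the good pairs. [folklore] -/
theorem fromU_toU : fromU m (toU m P) = P := by
  obtain ⟨h1, h2, hoff, _⟩ := mem_goodPairs.1 hP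
  have h1' := tuplesProd_subset h1
  have h2' := tuplesProd_subset h2
  rw [fromU, init_toU (m := m) P, ofNat_rad_of_mem h1', toU_last (m := m) P, hoff,
    ← mPart_eq_primeFactors_product h2' m, offPart_union_mPart]

end fwd

section bwd

variable {u : Fin (k + 1) → ℕ} (hu : u ∈ imgU k D₀ Rn m)
include hu

/-- The first `k` coordinates of a tuple of `imgU` form a pairwise coprime good `k`-tuple. [folklore] -/
theorem init_mem_coprimeTuples : Fin.init u ∈ coprimeTuples k D₀ Rn := by
  rw [imgU, Finset.mem_filter, coprimeTuples, Finset.mem_filter, goodTuples, Fintype.mem_piFinset] at hu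
  rw [coprimeTuples, Finset.mem_filter, goodTuples, Fintype.mem_piFinset]
  exact ⟨fun i => hu.1.1 i.castSucc, fun i j hij => hu.1.2 _ _ fun h => hij (Fin.castSucc_injective k h)⟩

/-- The reconstructed `r` is a support tuple of level `R`. [folklore] -/
theorem fromU_fst_mem : (fromU m u).1 ∈ tuplesProd k D₀ Rn := by
  have hc := init_mem_coprimeTuples hu
  rw [fromU, mem_tuplesProd]
  refine ⟨ofNat_mem_tuples hc, ?_⟩
  rw [← prod_rad, rad_ofNat_of_mem hc]
  exact (Finset.mem_filter.1 hu).2.1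

/-- The last coordinate of a tuple of `imgU` is good. [folklore] -/
theorem last_mem_goodNat : u (Fin.last k) ∈ goodNat D₀ Rn := by
  rw [imgU, Finset.mem_filter, coprimeTuples, Finset.mem_filter, goodTuples, Fintype.mem_piFinset] at hu
  exact hu.1.1 _

/-- The last coordinate of a tuple of `imgU` is coprime to each of the first `k`. [folklore] -/
theorem last_coprime_castSucc (j : Fin k) : (u (Fin.last k)).Coprime (u j.castSucc) := by
  rw [imgU, Finset.mem_filter, coprimeTuples, Finset.mem_filter] at hu
  exact hu.1.2 _ _ (Fin.castSucc_lt_last j).ne'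

/-- The reconstructed `s` is a support tuple. [folklore] -/
theorem fromU_snd_mem : (fromU m u).2 ∈ tuplesProd k D₀ Rn := by
  have hc := init_mem_coprimeTuples hu
  have hA := ofNat_mem_tuples hc
  have hfA := isFunctional_of_mem_tuples hA
  have hpA : ∀ x ∈ ofNat (Fin.init u), x.1.Prime := fun x hx => prime_of_mem_tuples hA hx
  have hl := last_mem_goodNat hu
  obtain ⟨hl1, hlsq, hlco⟩ := mem_goodNat_iff.1 hl
  have hl0 : u (Fin.last k) ≠ 0 := by have := (Finset.mem_Icc.1 hl1).1; omega
  rw [fromU]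
  dsimp only
  rw [mem_tuplesProd_iff]
  refine ⟨fun x hx => ?_, ?_, ?_⟩
  · rcases Finset.mem_union.1 hx with hx | hx
    · exact (mem_tuples.1 hA).1 x (offPart_subset _ _ hx)
    · obtain ⟨hp, _⟩ := Finset.mem_product.1 hx
      refine mem_primesIoc.2 ⟨⟨(coprime_primorial_iff hl0).1 hlco _ hp, ?_⟩, Nat.prime_of_mem_primeFactors hp⟩
      exact (Nat.le_of_mem_primeFactors hp).trans (Finset.mem_Icc.1 hl1).2
  · -- functional: a prime of `u_{k+1}` is not a prime of any `u_j`
    intro x hx y hy hxy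
    rcases Finset.mem_union.1 hx with hx | hx <;> rcases Finset.mem_union.1 hy with hy | hy
    · exact hfA x (offPart_subset _ _ hx) y (offPart_subset _ _ hy) hxy
    · exfalso
      obtain ⟨hyp, _⟩ := Finset.mem_product.1 hy
      have hxA := offPart_subset _ _ hx
      rw [mem_ofNat] at hxA
      have h1 := Nat.dvd_of_mem_primeFactors hxA
      have h2 := Nat.dvd_of_mem_primeFactors hyp
      rw [← hxy] at h2
      exact (Nat.prime_of_mem_primeFactors hxA).one_lt.ne'
        (Nat.eq_one_of_dvd_coprimes (last_coprime_castSucc hu x.2) h2 h1)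
    · exfalso
      obtain ⟨hxp, _⟩ := Finset.mem_product.1 hx
      have hyA := offPart_subset _ _ hy
      rw [mem_ofNat] at hyA
      have h1 := Nat.dvd_of_mem_primeFactors hyA
      have h2 := Nat.dvd_of_mem_primeFactors hxp
      rw [hxy] at h2
      exact (Nat.prime_of_mem_primeFactors hyA).one_lt.ne'
        (Nat.eq_one_of_dvd_coprimes (last_coprime_castSucc hu y.2) h2 h1)
    · obtain ⟨_, hxm⟩ := Finset.mem_product.1 hx
      obtain ⟨_, hym⟩ := Finset.mem_product.1 hy
      rw [Finset.mem_singleton] at hxm hym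
      exact Prod.ext hxy (hxm.trans hym.symm)
  · rw [Finset.prod_union, prod_offPart_eq, Finset.prod_product, Finset.prod_congr rfl fun p _ => Finset.prod_singleton _ _,
      Nat.prod_primeFactors_of_squarefree hlsq]
    · simp_rw [rad_ofNat_of_mem hc]
      exact (Finset.mem_filter.1 hu).2.2
    · rw [Finset.disjoint_left]
      intro x hx hx'
      obtain ⟨hxp, _⟩ := Finset.mem_product.1 hx'
      have hxA := offPart_subset _ _ hx
      rw [mem_ofNat] at hxA
      exact (Nat.prime_of_mem_primeFactors hxA).one_lt.ne'
        (Nat.eq_one_of_dvd_coprimes (last_coprime_castSucc hu x.2) (Nat.dvd_of_mem_primeFactors hxp)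
          (Nat.dvd_of_mem_primeFactors hxA))

omit hu in
/-- The reconstructed pair has equal off-parts. [folklore] -/
theorem offPart_fromU_snd : offPart (fromU m u).2 m = offPart (fromU m u).1 m := by
  set A := ofNat (Fin.init u)
  have hY : ((u (Fin.last k)).primeFactors ×ˢ ({m} : Finset (Fin k))).filter (fun x => x.2 ≠ m) = ∅ :=
    Finset.filter_eq_empty_iff.2 fun x hx => by
      obtain ⟨_, hxm⟩ := Finset.mem_product.1 hx
      rw [Finset.mem_singleton] at hxm
      exact fun h => h hxm
  have hX : (offPart A m).filter (fun x => x.2 ≠ m) = offPart A m := by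
    rw [offPart, Finset.filter_filter]; exact Finset.filter_congr fun x _ => and_self_iff
  show (offPart A m ∪ (u (Fin.last k)).primeFactors ×ˢ ({m} : Finset (Fin k))).filter (fun x => x.2 ≠ m) = offPart A m
  rw [Finset.filter_union, hX, hY, Finset.union_empty]

omit hu in
/-- The `m`-part of the reconstructed `s` is the set of primes of `u_{k+1}`, tagged `m`. [folklore] -/
theorem mPart_fromU_snd : mPart (fromU m u).2 m = (u (Fin.last k)).primeFactors ×ˢ {m} := by
  set A := ofNat (Fin.init u)
  have hX : (offPart A m).filter (fun x => x.2 = m) = ∅ :=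
    Finset.filter_eq_empty_iff.2 fun x hx => (mem_offPart.1 hx).2
  have hY : ((u (Fin.last k)).primeFactors ×ˢ ({m} : Finset (Fin k))).filter (fun x => x.2 = m) =
      (u (Fin.last k)).primeFactors ×ˢ ({m} : Finset (Fin k)) :=
    Finset.filter_true_of_mem fun x hx => by
      obtain ⟨_, hxm⟩ := Finset.mem_product.1 hx
      exact Finset.mem_singleton.1 hxm
  show (offPart A m ∪ (u (Fin.last k)).primeFactors ×ˢ ({m} : Finset (Fin k))).filter (fun x => x.2 = m) = _
  rw [Finset.filter_union, hX, hY, Finset.empty_union]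

/-- The `m`-component of the reconstructed `s` is `u_{k+1}`. [folklore] -/
theorem rad_fromU_snd_m : rad (fromU m u).2 m = u (Fin.last k) := by
  have hl := last_mem_goodNat hu
  obtain ⟨_, hlsq, _⟩ := mem_goodNat_iff.1 hl
  rw [rad, show (fromU m u).2.filter (fun x => x.2 = m) = mPart (fromU m u).2 m from rfl, mPart_fromU_snd (m := m) (u := u),
    Finset.prod_product, Finset.prod_congr rfl fun p _ => Finset.prod_singleton _ _, Nat.prod_primeFactors_of_squarefree hlsq]

/-- `fromU` maps `imgU` into the good pairs. [folklore] -/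
theorem fromU_mem_goodPairs : fromU m u ∈ goodPairs k D₀ Rn m := by
  have hc := init_mem_coprimeTuples hu
  have hA := ofNat_mem_tuples hc
  rw [mem_goodPairs]
  refine ⟨fromU_fst_mem hu, fromU_snd_mem hu, (offPart_fromU_snd (m := m) (u := u)).symm, ?_⟩
  rw [mPart_fromU_snd (m := m) (u := u), Finset.disjoint_left]
  intro p hp hp'
  rw [fromU] at hp
  dsimp only at hp
  obtain ⟨x, hx, rfl⟩ := Finset.mem_image.1 hp
  obtain ⟨y, hy, hyx⟩ := Finset.mem_image.1 hp'
  obtain ⟨hyp, _⟩ := Finset.mem_product.1 hy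
  rw [hyx] at hyp
  have hxA := mPart_subset _ _ hx
  rw [mem_ofNat] at hxA
  exact (Nat.prime_of_mem_primeFactors hxA).one_lt.ne'
    (Nat.eq_one_of_dvd_coprimes (last_coprime_castSucc hu x.2) (Nat.dvd_of_mem_primeFactors hyp)
      (Nat.dvd_of_mem_primeFactors hxA))

/-- `toU ∘ fromU = id` on `imgU`. [folklore] -/
theorem toU_fromU : toU m (fromU m u) = u := by
  have hc := init_mem_coprimeTuples hu
  rw [toU, rad_fromU_snd_m hu, show (fromU m u).1 = ofNat (Fin.init u) from rfl, rad_ofNat_of_mem hc,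
    Fin.snoc_init_self]

end bwd

/-- **Reindexing the good pairs by `(k+1)`-tuples of integers.** [folklore] -/
theorem sum_goodPairs_eq_sum_imgU (Φ : (Fin (k + 1) → ℕ) → ℝ) :
    ∑ P ∈ goodPairs k D₀ Rn m, Φ (toU m P) = ∑ u ∈ imgU k D₀ Rn m, Φ u :=
  Finset.sum_nbij' (toU m) (fromU m) (fun _ hP => toU_mem_imgU hP) (fun _ hu => fromU_mem_goodPairs hu)
    (fun _ hP => fromU_toU hP) (fun _ hu => toU_fromU hu) fun _ _ => rfl

end GoodPairs

/-! ### The good-pair sum of `S₂^{(m)}` as a weighted sum over `(k+1)`-tuples -/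

section GoodPairSum

variable {D₀ Rn : ℕ} {R : ℝ} (m : Fin k)

/-- The weights of the `(k+1)`-tuple: `w₂` on the coordinates `j ≠ m`, `w₁` on `m` and on `k+1`
(Maynard: `μ(u)²/φ(u)` for the variable of Lemma 5.3, `μ(r)²φ(r)/(g(r) r)` for the `rⱼ`, `j ≠ m`).
[cite: MaynardAnnals2015, proof of Lemma 6.3 (the two applications of Lemma 6.1)] -/
noncomputable def wvec (m : Fin k) : Fin (k + 1) → ℕ → ℝ :=
  Fin.snoc (fun j => if j = m then wOne else wTwo) wOne

/-- The `k`-tuple `(u_1, …, u_{m-1}, u_{k+1}, u_{m+1}, …, u_k)`. [folklore] -/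
def swapU (m : Fin k) (u : Fin (k + 1) → ℕ) : Fin k → ℕ := fun j => if j = m then u (Fin.last k) else u j.castSucc

/-- The real version of `swapU`. [folklore] -/
def swapT (m : Fin k) (t : Fin (k + 1) → ℝ) : Fin k → ℝ := fun j => if j = m then t (Fin.last k) else t j.castSucc

/-- `logPos` commutes with `Fin.init`. [folklore] -/
theorem logPos_init (R : ℝ) (u : Fin (k + 1) → ℕ) : logPos R (Fin.init u) = Fin.init (logPos R u) := rfl

/-- `logPos` intertwines `swapU` and `swapT`. [folklore] -/
theorem logPos_swapU (R : ℝ) (u : Fin (k + 1) → ℕ) : logPos R (swapU m u) = swapT m (logPos R u) := by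
  funext j; simp only [logPos, swapU, swapT]; split_ifs <;> rfl

/-- The test function of the `(k+1)`-dimensional sum: `F(t_1..t_k) F(t_1..t_{m-1}, t_{k+1}, t_{m+1}..t_k)`.
[cite: MaynardAnnals2015, Lemma 6.3 (J_k^{(m)})] -/
noncomputable def Gtwo (m : Fin k) (F : (Fin k → ℝ) → ℝ) (t : Fin (k + 1) → ℝ) : ℝ :=
  F (Fin.init t) * F (swapT m t)

variable {m}

/-- For a good pair, moving `u_{k+1} = s_m` into position `m` recovers `s`. [folklore] -/
theorem swapU_toU {P : Finset (ℕ × Fin k) × Finset (ℕ × Fin k)} (hP : P ∈ goodPairs k D₀ Rn m) :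
    swapU m (toU m P) = rad P.2 := by
  obtain ⟨_, _, hoff, _⟩ := mem_goodPairs.1 hP
  funext j
  simp only [swapU]
  split_ifs with hj
  · rw [hj, toU_last]
  · rw [toU_castSucc, rad_eq_of_offPart_eq hoff hj]

/-- `∏ⱼ (swapU m u)ⱼ = (∏_{j ≠ m} u_j) · u_{k+1}`. [folklore] -/
theorem prod_swapU (u : Fin (k + 1) → ℕ) :
    ∏ j, swapU m u j = (∏ j ∈ (Finset.univ : Finset (Fin k)).erase m, u j.castSucc) * u (Fin.last k) := by
  rw [← Finset.prod_erase_mul _ _ (Finset.mem_univ m)]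
  simp only [swapU, if_true]
  congr 1
  exact Finset.prod_congr rfl fun j hj => by rw [if_neg (Finset.ne_of_mem_erase hj)]

/-- The weight of a good pair is the product weight of its `(k+1)`-tuple. [folklore] -/
theorem goodW_eq_prod_sfw {P : Finset (ℕ × Fin k) × Finset (ℕ × Fin k)} (hP : P ∈ goodPairs k D₀ Rn m) :
    goodW m P = ∏ i, sfw (primorial D₀) (wvec m i) (toU m P i) := by
  obtain ⟨h1, h2, _, _⟩ := mem_goodPairs.1 hP
  have h1' := tuplesProd_subset h1
  have h2' := tuplesProd_subset h2
  have hf1 := isFunctional_of_mem_tuples h1'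
  have hf2 := isFunctional_of_mem_tuples h2'
  rw [Fin.prod_univ_castSucc]
  simp only [wvec, toU, Fin.snoc_castSucc, Fin.snoc_last]
  have hfib : (∏ j : Fin k, sfw (primorial D₀) (if j = m then wOne else wTwo) (rad P.1 j)) =
      ∏ x ∈ P.1, (if x.2 = m then wOne else wTwo) x.1 := by
    rw [← Finset.prod_fiberwise P.1 Prod.snd (fun x => (if x.2 = m then wOne else wTwo) x.1)]
    refine Finset.prod_congr rfl fun j _ => ?_
    rw [sfw_rad _ h1' j]
    exact Finset.prod_congr rfl fun x hx => by rw [(Finset.mem_filter.1 hx).2]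
  have hsplit : ∏ x ∈ P.1, (if x.2 = m then wOne else wTwo) x.1 =
      (∏ x ∈ offPart P.1 m, wTwo x.1) * ∏ x ∈ mPart P.1 m, wOne x.1 := by
    conv_lhs => rw [← offPart_union_mPart P.1 m]
    rw [Finset.prod_union (disjoint_offPart_mPart P.1 m)]
    congr 1
    · exact Finset.prod_congr rfl fun x hx => by rw [if_neg (mem_offPart.1 hx).2]
    · exact Finset.prod_congr rfl fun x hx => by rw [if_pos (mem_mPart.1 hx).2]
  rw [hfib, hsplit, sfw_rad wOne h2' m, goodW,
    ← prod_eq_prod_image_fst (hf1.subset (offPart_subset _ _)) wTwo,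
    ← prod_eq_prod_image_fst (hf1.subset (mPart_subset _ _)) wOne,
    ← prod_eq_prod_image_fst (hf2.subset (mPart_subset _ _)) wOne]
  rw [show P.2.filter (fun x => x.2 = m) = mPart P.2 m from rfl]
  ring

/-- A tuple with product exceeding `R` has logarithmic position outside the simplex. [folklore] -/
theorem indicator_logPos_eq_zero_of_lt_prod (hR : 1 < R) (hRn : Rn = ⌊R⌋₊) (Gf : (Fin k → ℝ) → ℝ)
    {v : Fin k → ℕ} (hv : ∀ j, 1 ≤ v j) (h : Rn < ∏ j, v j) :
    (maynardSimplex k).indicator Gf (logPos R v) = 0 := by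
  refine Set.indicator_of_notMem (fun hmem => ?_) _
  have hsum := hmem.2
  have hlogR : 0 < Real.log R := Real.log_pos hR
  simp only [logPos] at hsum
  rw [← Finset.sum_div, div_le_one hlogR, ← Real.log_prod (s := Finset.univ) (f := fun i => ((v i : ℕ) : ℝ))
    (fun i _ => by have := hv i; positivity)] at hsum
  have h0 : (0:ℝ) < ∏ i, (v i : ℝ) := Finset.prod_pos fun i _ => by exact_mod_cast hv i
  have hle : ((∏ i, v i : ℕ) : ℝ) ≤ R := by
    have := (Real.log_le_log_iff h0 (by linarith)).1 hsum
    push_cast; exact this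
  have := Nat.le_floor hle
  rw [← hRn] at this
  omega

/-- **The good-pair sum as a `(k+1)`-dimensional weighted sum over pairwise coprime tuples**
(the sum of the proof of Lemma 6.3 with the square `(∑_{a_m} y/φ(a_m))²` of Lemma 5.3 expanded into two
variables): with `y_A = F(t_A)`, `F = 1_{R_k} G`,
`∑_{good} y_A y_{A'} goodW = ∑_{u pairwise coprime} (∏ sfw_{wvec i}(uᵢ)) F(t(u_1..u_k)) F(t(…u_{k+1}…))`.
[cite: MaynardAnnals2015, proof of Lemma 6.3 (substitution of Lemma 5.3 and of the choice of y into Lemma 5.2)] -/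
theorem sum_goodPairs_eq_sum_coprimeTuples (hR : 1 < R) (hRn : Rn = ⌊R⌋₊) (Gf : (Fin k → ℝ) → ℝ) :
    ∑ P ∈ goodPairs k D₀ Rn m,
        (maynardSimplex k).indicator Gf (logPos R (rad P.1)) * (maynardSimplex k).indicator Gf (logPos R (rad P.2)) *
          goodW m P =
      ∑ u ∈ coprimeTuples (k + 1) D₀ Rn, (∏ i, sfw (primorial D₀) (wvec m i) (u i)) *
        Gtwo m ((maynardSimplex k).indicator Gf) (logPos R u) := by
  set F := (maynardSimplex k).indicator Gf with hF
  set Φ : (Fin (k + 1) → ℕ) → ℝ := fun u => (∏ i, sfw (primorial D₀) (wvec m i) (u i)) * Gtwo m F (logPos R u) with hΦ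
  -- summand identity on good pairs
  have hsummand : ∀ P ∈ goodPairs k D₀ Rn m, F (logPos R (rad P.1)) * F (logPos R (rad P.2)) * goodW m P = Φ (toU m P) := by
    intro P hP
    rw [hΦ]
    dsimp only
    rw [Gtwo, ← logPos_init, init_toU, ← logPos_swapU, swapU_toU hP, goodW_eq_prod_sfw hP]
    ring
  rw [Finset.sum_congr rfl hsummand, sum_goodPairs_eq_sum_imgU Φ, imgU]
  -- extend from `imgU` to all pairwise coprime tuples
  refine Finset.sum_subset (Finset.filter_subset _ _) fun u hu hu' => ?_
  rw [Finset.mem_filter, not_and] at hu'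
  have hcond := hu' hu
  rw [coprimeTuples, Finset.mem_filter, goodTuples, Fintype.mem_piFinset] at hu
  have hu1 : ∀ i, 1 ≤ u i := fun i => (Finset.mem_Icc.1 (mem_goodNat_iff.1 (hu.1 i)).1).1
  rw [hΦ]
  dsimp only
  rw [Gtwo, ← logPos_init, ← logPos_swapU, hF]
  rcases not_and_or.1 hcond with h1 | h2
  · rw [indicator_logPos_eq_zero_of_lt_prod (v := Fin.init u) hR hRn Gf (fun j => hu1 _) (not_le.1 h1)]; ring
  · rw [indicator_logPos_eq_zero_of_lt_prod (v := swapU m u) hR hRn Gf ?_ ?_]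
    · ring
    · intro j; simp only [swapU]; split_ifs <;> exact hu1 _
    · rw [prod_swapU]; exact not_le.1 h2

end GoodPairSum

/-! ### The test functions as cut-off continuous functions; continuity data -/

section TestFunctions

open MeasureTheory Set

variable (m : Fin k)

/-- `F² = 1_{R_k} G²` for `F = 1_{R_k} G`. [folklore] -/
theorem sq_indicator_eq_polytope_indicator (Gf : (Fin k → ℝ) → ℝ) (t : Fin k → ℝ) :
    ((maynardSimplex k).indicator Gf t) ^ 2 =
      (polytope (fun _ : Unit => (Finset.univ : Finset (Fin k)))).indicator (fun t => Gf t ^ 2) t := by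
  rw [polytope_univ_eq_maynardSimplex]
  by_cases h : t ∈ maynardSimplex k
  · rw [Set.indicator_of_mem h, Set.indicator_of_mem h]
  · rw [Set.indicator_of_notMem h, Set.indicator_of_notMem h]; ring

/-- The two constraints of the `J^{(m)}`-integrand's support: `∑_{i ≤ k} tᵢ ≤ 1` and
`∑_{i ≤ k, i ≠ m} tᵢ + t_{k+1} ≤ 1`. [cite: MaynardAnnals2015, proof of Lemma 6.3] -/
def Stwo (m : Fin k) : Bool → Finset (Fin (k + 1)) := fun b =>
  if b then (Finset.univ : Finset (Fin k)).image Fin.castSucc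
  else insert (Fin.last k) (((Finset.univ : Finset (Fin k)).erase m).image Fin.castSucc)

/-- The first constraint is `t_1 + ⋯ + t_k`. [folklore] -/
theorem sum_Stwo_true (t : Fin (k + 1) → ℝ) : ∑ i ∈ Stwo m true, t i = ∑ j : Fin k, t j.castSucc := by
  rw [Stwo, if_pos rfl, Finset.sum_image fun a _ b _ h => Fin.castSucc_injective k h]

/-- The second constraint is `t_{k+1} + ∑_{j ≠ m} t_j`. [folklore] -/
theorem sum_Stwo_false (t : Fin (k + 1) → ℝ) :
    ∑ i ∈ Stwo m false, t i = t (Fin.last k) + ∑ j ∈ (Finset.univ : Finset (Fin k)).erase m, t j.castSucc := by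
  rw [Stwo]
  simp only [Bool.false_eq_true, ↓reduceIte]
  rw [Finset.sum_insert, Finset.sum_image fun a _ b _ h => Fin.castSucc_injective k h]
  rw [Finset.mem_image]
  rintro ⟨j, _, hj⟩
  exact (Fin.castSucc_lt_last j).ne hj

/-- `∑ⱼ (swapT m t)ⱼ = t_{k+1} + ∑_{j ≠ m} t_j`. [folklore] -/
theorem sum_swapT (t : Fin (k + 1) → ℝ) :
    ∑ j, swapT m t j = t (Fin.last k) + ∑ j ∈ (Finset.univ : Finset (Fin k)).erase m, t j.castSucc := by
  rw [← Finset.add_sum_erase _ _ (Finset.mem_univ m)]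
  simp only [swapT, if_true]
  congr 1
  exact Finset.sum_congr rfl fun j hj => by rw [if_neg (Finset.ne_of_mem_erase hj)]

/-- Support of the `J^{(m)}`-integrand: `init t ∈ R_k ∧ swap t ∈ R_k ↔ t ∈ polytope (Stwo m)`. [folklore] -/
theorem init_mem_and_swapT_mem_iff (t : Fin (k + 1) → ℝ) :
    (Fin.init t ∈ maynardSimplex k ∧ swapT m t ∈ maynardSimplex k) ↔ t ∈ polytope (Stwo m) := by
  rw [mem_polytope]
  simp only [maynardSimplex, Set.mem_setOf_eq, Bool.forall_bool, sum_Stwo_false, sum_Stwo_true, sum_swapT,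
    maynardCube, Set.mem_univ_pi, Set.mem_Icc]
  constructor
  · rintro ⟨⟨h0, hs⟩, ⟨h0', hs'⟩⟩
    have hlast : 0 ≤ t (Fin.last k) := by have := h0' m; simpa [swapT] using this
    refine ⟨fun i => ?_, hs', hs⟩
    refine Fin.lastCases ?_ (fun j => ?_) i
    · refine ⟨hlast, le_trans ?_ hs'⟩
      have : 0 ≤ ∑ j ∈ (Finset.univ : Finset (Fin k)).erase m, t j.castSucc :=
        Finset.sum_nonneg fun j _ => h0 j
      linarith
    · exact ⟨h0 j, le_trans (Finset.single_le_sum (fun j _ => h0 j) (Finset.mem_univ j)) hs⟩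
  · rintro ⟨hc, hs', hs⟩
    refine ⟨⟨fun j => (hc j.castSucc).1, hs⟩, fun j => ?_, hs'⟩
    simp only [swapT]; split_ifs
    · exact (hc _).1
    · exact (hc _).1

/-- `Gtwo` of a cut-off function is the cut-off of the product. [folklore] -/
theorem Gtwo_indicator_eq (Gf : (Fin k → ℝ) → ℝ) (t : Fin (k + 1) → ℝ) :
    Gtwo m ((maynardSimplex k).indicator Gf) t =
      (polytope (Stwo m)).indicator (fun t => Gf (Fin.init t) * Gf (swapT m t)) t := by
  rw [Gtwo]
  by_cases h : t ∈ polytope (Stwo m)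
  · obtain ⟨h1, h2⟩ := (init_mem_and_swapT_mem_iff m t).2 h
    rw [Set.indicator_of_mem h, Set.indicator_of_mem h1, Set.indicator_of_mem h2]
  · rw [Set.indicator_of_notMem h]
    rw [← init_mem_and_swapT_mem_iff m t, not_and_or] at h
    rcases h with h | h
    · rw [Set.indicator_of_notMem h, zero_mul]
    · rw [Set.indicator_of_notMem h, mul_zero]

/-- **Continuity data of a continuous function on the cube**: a bound and a modulus of continuity
for the sup-distance. [folklore] -/
theorem exists_bound_and_modulus {k' : ℕ} {g : (Fin k' → ℝ) → ℝ} (hg : Continuous g) :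
    ∃ Gmax : ℝ, 0 ≤ Gmax ∧ (∀ t ∈ maynardCube k', |g t| ≤ Gmax) ∧
      ∀ ω > 0, ∃ δ > 0, ∀ t ∈ maynardCube k', ∀ t' ∈ maynardCube k', (∀ i, |t i - t' i| ≤ δ) → |g t - g t'| ≤ ω := by
  have hK : IsCompact (maynardCube k') := isCompact_univ_pi fun _ => isCompact_Icc
  obtain ⟨B, hB⟩ := hK.exists_bound_of_continuousOn hg.continuousOn
  refine ⟨max B 0, le_max_right _ _, fun t ht => (hB t ht).trans (le_max_left _ _) |> fun h => by
    rw [← Real.norm_eq_abs]; exact h, fun ω hω => ?_⟩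
  have huc := hK.uniformContinuousOn_of_continuous hg.continuousOn
  rw [Metric.uniformContinuousOn_iff] at huc
  obtain ⟨δ, hδ, h⟩ := huc ω hω
  refine ⟨δ / 2, by positivity, fun t ht t' ht' hd => ?_⟩
  have hdist : dist t t' < δ := by
    refine lt_of_le_of_lt ?_ (half_lt_self hδ)
    rw [dist_pi_le_iff (by positivity)]
    intro i; rw [Real.dist_eq]; exact hd i
  have := h t ht t' ht' hdist
  rw [Real.dist_eq] at this
  exact this.le

/-- `Fin.init` maps the cube `[0,1]^{k+1}` to `[0,1]^k`. [folklore] -/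
theorem init_mem_maynardCube {t : Fin (k + 1) → ℝ} (ht : t ∈ maynardCube (k + 1)) : Fin.init t ∈ maynardCube k :=
  fun j _ => ht j.castSucc (Set.mem_univ _)

/-- `swapT m` maps the cube `[0,1]^{k+1}` to `[0,1]^k`. [folklore] -/
theorem swapT_mem_maynardCube {t : Fin (k + 1) → ℝ} (ht : t ∈ maynardCube (k + 1)) : swapT m t ∈ maynardCube k := by
  intro j _
  simp only [swapT]; split_ifs
  · exact ht _ (Set.mem_univ _)
  · exact ht _ (Set.mem_univ _)

/-- Continuity data (bound `G_max²`, modulus `2 G_max ω`) for `G²` from those of `G`. [folklore] -/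
theorem modulus_sq {k' : ℕ} {g : (Fin k' → ℝ) → ℝ} {Gmax ω δ : ℝ} (hGmax : 0 ≤ Gmax)
    (hb : ∀ t ∈ maynardCube k', |g t| ≤ Gmax)
    (hm : ∀ t ∈ maynardCube k', ∀ t' ∈ maynardCube k', (∀ i, |t i - t' i| ≤ δ) → |g t - g t'| ≤ ω) :
    (∀ t ∈ maynardCube k', |g t ^ 2| ≤ Gmax ^ 2) ∧
    (∀ t ∈ maynardCube k', ∀ t' ∈ maynardCube k', (∀ i, |t i - t' i| ≤ δ) → |g t ^ 2 - g t' ^ 2| ≤ 2 * Gmax * ω) := by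
  refine ⟨fun t ht => ?_, fun t ht t' ht' hd => ?_⟩
  · rw [abs_pow]; exact pow_le_pow_left₀ (abs_nonneg _) (hb t ht) 2
  · have h1 := hb t ht; have h2 := hb t' ht'; have h3 := hm t ht t' ht' hd
    rw [show g t ^ 2 - g t' ^ 2 = (g t + g t') * (g t - g t') by ring, abs_mul]
    calc |g t + g t'| * |g t - g t'| ≤ (Gmax + Gmax) * ω := by
          refine mul_le_mul ((abs_add_le _ _).trans (add_le_add h1 h2)) h3 (abs_nonneg _) (by linarith)
      _ = 2 * Gmax * ω := by ring

/-- Continuity data (bound `G_max²`, modulus `2 G_max ω`) for the `J^{(m)}`-integrand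
`G(init t) G(swapT m t)` from those of `G`. [folklore] -/
theorem modulus_Gtwo {g : (Fin k → ℝ) → ℝ} {Gmax ω δ : ℝ} (hGmax : 0 ≤ Gmax)
    (hb : ∀ t ∈ maynardCube k, |g t| ≤ Gmax)
    (hm : ∀ t ∈ maynardCube k, ∀ t' ∈ maynardCube k, (∀ i, |t i - t' i| ≤ δ) → |g t - g t'| ≤ ω) :
    (∀ t ∈ maynardCube (k + 1), |g (Fin.init t) * g (swapT m t)| ≤ Gmax ^ 2) ∧
    (∀ t ∈ maynardCube (k + 1), ∀ t' ∈ maynardCube (k + 1), (∀ i, |t i - t' i| ≤ δ) →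
      |g (Fin.init t) * g (swapT m t) - g (Fin.init t') * g (swapT m t')| ≤ 2 * Gmax * ω) := by
  refine ⟨fun t ht => ?_, fun t ht t' ht' hd => ?_⟩
  · rw [abs_mul, sq]
    exact mul_le_mul (hb _ (init_mem_maynardCube ht)) (hb _ (swapT_mem_maynardCube m ht)) (abs_nonneg _) hGmax
  · have hdi : ∀ j, |Fin.init t j - Fin.init t' j| ≤ δ := fun j => hd j.castSucc
    have hds : ∀ j, |swapT m t j - swapT m t' j| ≤ δ := fun j => by
      simp only [swapT]; split_ifs
      · exact hd _
      · exact hd _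
    have e1 := hm _ (init_mem_maynardCube ht) _ (init_mem_maynardCube ht') hdi
    have e2 := hm _ (swapT_mem_maynardCube m ht) _ (swapT_mem_maynardCube m ht') hds
    have b1 := hb _ (init_mem_maynardCube ht)
    have b2 := hb _ (swapT_mem_maynardCube m ht')
    rw [show g (Fin.init t) * g (swapT m t) - g (Fin.init t') * g (swapT m t') =
      g (Fin.init t) * (g (swapT m t) - g (swapT m t')) + (g (Fin.init t) - g (Fin.init t')) * g (swapT m t') by ring]
    calc _ ≤ |g (Fin.init t) * (g (swapT m t) - g (swapT m t'))| + |(g (Fin.init t) - g (Fin.init t')) * g (swapT m t')| :=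
          abs_add_le _ _
      _ ≤ Gmax * ω + ω * Gmax := by
          rw [abs_mul, abs_mul]
          exact add_le_add (mul_le_mul b1 e2 (abs_nonneg _) hGmax)
            (mul_le_mul e1 b2 (abs_nonneg _) (le_trans (abs_nonneg _) e1))
      _ = 2 * Gmax * ω := by ring

end TestFunctions

/-! ### The integrals: `∫_{[0,1]^k} F² = I_k(F)` and `∫_{[0,1]^{k+1}} Gtwo = J_k^{(m)}(F)` -/

section Integrals

open MeasureTheory Set

/-- `∫_{[0,1]^k} F² = I_k(F)` for `F = 1_{R_k} G`. [cite: MaynardAnnals2015, Proposition 4.1 (definition of I_k)] -/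
theorem integral_cube_sq_indicator (Gf : (Fin k → ℝ) → ℝ) :
    ∫ t in maynardCube k, ((maynardSimplex k).indicator Gf t) ^ 2 = maynardI k ((maynardSimplex k).indicator Gf) := by
  have hind : ∀ t, ((maynardSimplex k).indicator Gf t) ^ 2 = (maynardSimplex k).indicator (fun t => Gf t ^ 2) t := by
    intro t
    by_cases h : t ∈ maynardSimplex k
    · rw [Set.indicator_of_mem h, Set.indicator_of_mem h]
    · rw [Set.indicator_of_notMem h, Set.indicator_of_notMem h]; ring
  rw [maynardI]
  simp_rw [hind]
  rw [setIntegral_indicator (measurableSet_maynardSimplex k), setIntegral_indicator (measurableSet_maynardSimplex k),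
    Set.inter_self, Set.inter_eq_right.2 (maynardSimplex_subset_maynardCube k)]

variable {n : ℕ}

/-- `1_{R_k} G` is measurable for continuous `G`. [folklore] -/
theorem measurable_indicator_of_continuous {k' : ℕ} {Gf : (Fin k' → ℝ) → ℝ} (hG : Continuous Gf) :
    Measurable ((maynardSimplex k').indicator Gf) :=
  hG.measurable.indicator (measurableSet_maynardSimplex k')

/-- `|1_{R_k} G| ≤ G_max` everywhere if `|G| ≤ G_max` on the cube and `G_max ≥ 0`. [folklore] -/
theorem abs_indicator_le {k' : ℕ} {Gf : (Fin k' → ℝ) → ℝ} {Gmax : ℝ} (hGmax : 0 ≤ Gmax)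
    (hb : ∀ t ∈ maynardCube k', |Gf t| ≤ Gmax) (t : Fin k' → ℝ) :
    |(maynardSimplex k').indicator Gf t| ≤ Gmax := by
  by_cases h : t ∈ maynardSimplex k'
  · rw [Set.indicator_of_mem h]; exact hb t (maynardSimplex_subset_maynardCube k' h)
  · rw [Set.indicator_of_notMem h, abs_zero]; exact hGmax

/-- `swapT m (t', s) = t'` with `s` substituted at `m`. [folklore] -/
theorem swapT_snoc (m : Fin (n + 1)) (t' : Fin (n + 1) → ℝ) (s : ℝ) :
    swapT m (Fin.snoc t' s : Fin (n + 2) → ℝ) = Function.update t' m s := by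
  funext j
  simp only [swapT]
  split_ifs with h
  · rw [h, Fin.snoc_last, Function.update_self]
  · rw [Fin.snoc_castSucc, Function.update_of_ne h]

/-- **`∫_{[0,1]^{k+1}} F(t_1..t_k) F(t_1..t_{m-1},t_{k+1},t_{m+1}..t_k) dt = J_k^{(m)}(F)`** for
`F = 1_{R_k} G`, `G` continuous: both sides equal `∫ (∫₀¹ F(…, u at m, …) du)²`.
[cite: MaynardAnnals2015, Proposition 4.1 (definition of J_k^{(m)}) and Lemma 6.3] -/
theorem integral_cube_Gtwo_succ (m : Fin (n + 1)) {Gf : (Fin (n + 1) → ℝ) → ℝ} (hG : Continuous Gf) :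
    ∫ t in maynardCube (n + 2), Gtwo m ((maynardSimplex (n + 1)).indicator Gf) t =
      maynardJ (n + 1) m ((maynardSimplex (n + 1)).indicator Gf) := by
  set F := (maynardSimplex (n + 1)).indicator Gf with hF
  have hFm : Measurable F := measurable_indicator_of_continuous hG
  obtain ⟨Gmax, hGmax, hb, -⟩ := exists_bound_and_modulus hG
  have hFb : ∀ t, |F t| ≤ Gmax := abs_indicator_le hGmax hb
  -- Step 1: split off the last coordinate
  set e := MeasurableEquiv.piFinSuccAbove (fun _ : Fin (n + 2) => ℝ) (Fin.last (n + 1)) with he_def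
  have he : MeasurePreserving e.symm (volume.prod volume) volume := by
    have := (volume_preserving_piFinSuccAbove (fun _ : Fin (n + 2) => ℝ) (Fin.last (n + 1))).symm
    rwa [Measure.volume_eq_prod] at this
  have he_apply : ∀ p : ℝ × (Fin (n + 1) → ℝ), e.symm p = (Fin.snoc p.2 p.1 : Fin (n + 2) → ℝ) := fun p => by
    rw [he_def, MeasurableEquiv.piFinSuccAbove_symm_apply]
    exact Fin.insertNth_last' p.1 p.2
  have hpre : e.symm ⁻¹' maynardCube (n + 2) = Icc (0:ℝ) 1 ×ˢ maynardCube (n + 1) := by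
    ext ⟨x, s⟩
    simp only [maynardCube, Set.mem_preimage, he_apply, Set.mem_pi, Set.mem_univ, true_implies, Set.mem_prod]
    rw [Fin.forall_fin_succ']
    simp only [Fin.snoc_castSucc, Fin.snoc_last]
    tauto
  rw [← he.setIntegral_preimage_emb e.symm.measurableEmbedding, hpre]
  simp_rw [he_apply]
  have hG2 : ∀ p : ℝ × (Fin (n + 1) → ℝ), Gtwo m F (Fin.snoc p.2 p.1 : Fin (n + 2) → ℝ) = F p.2 * F (Function.update p.2 m p.1) := by
    intro p; rw [Gtwo, Fin.init_snoc, swapT_snoc]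
  simp_rw [hG2]
  -- finiteness of the restricted measures
  haveI hI1 : IsFiniteMeasure ((volume : Measure ℝ).restrict (Icc (0:ℝ) 1)) :=
    isFiniteMeasure_restrict.2 measure_Icc_lt_top.ne
  have hcubefin : ∀ k', (volume : Measure (Fin k' → ℝ)) (maynardCube k') < ⊤ := fun k' => by
    rw [maynardCube]
    exact (isCompact_univ_pi fun _ => isCompact_Icc).measure_lt_top
  haveI hI2 : IsFiniteMeasure ((volume : Measure (Fin (n + 1) → ℝ)).restrict (maynardCube (n + 1))) :=
    isFiniteMeasure_restrict.2 (hcubefin _).ne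
  haveI hI3 : IsFiniteMeasure ((volume : Measure (Fin n → ℝ)).restrict (maynardCube n)) :=
    isFiniteMeasure_restrict.2 (hcubefin _).ne
  -- generic integrability of bounded measurable functions on these finite measures
  have hint2 : ∀ (f : ℝ × (Fin (n + 1) → ℝ) → ℝ), Measurable f → (∀ p, |f p| ≤ Gmax ^ 2) →
      IntegrableOn f (Icc (0:ℝ) 1 ×ˢ maynardCube (n + 1)) (volume.prod volume) := by
    intro f hf hfb
    rw [IntegrableOn, ← Measure.prod_restrict]
    exact Integrable.of_bound hf.aestronglyMeasurable (Gmax ^ 2) (ae_of_all _ fun p => by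
      rw [Real.norm_eq_abs]; exact hfb p)
  have hmeas1 : Measurable fun p : ℝ × (Fin (n + 1) → ℝ) => F p.2 * F (Function.update p.2 m p.1) := by
    refine (hFm.comp measurable_snd).mul (hFm.comp ?_)
    exact (continuous_snd.update m continuous_fst).measurable
  rw [setIntegral_prod _ (hint2 _ hmeas1 fun p => by
    rw [abs_mul, sq]; exact mul_le_mul (hFb _) (hFb _) (abs_nonneg _) hGmax)]
  -- Step 2: the inner integral, split at `m`
  set e₂ := MeasurableEquiv.piFinSuccAbove (fun _ : Fin (n + 1) => ℝ) m with he₂_def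
  have he₂ : MeasurePreserving e₂.symm (volume.prod volume) volume := by
    have := (volume_preserving_piFinSuccAbove (fun _ : Fin (n + 1) => ℝ) m).symm
    rwa [Measure.volume_eq_prod] at this
  have he₂_apply : ∀ p : ℝ × (Fin n → ℝ), e₂.symm p = Fin.insertNth m p.1 p.2 := fun p => by
    rw [he₂_def, MeasurableEquiv.piFinSuccAbove_symm_apply]; rfl
  have hpre₂ : e₂.symm ⁻¹' maynardCube (n + 1) = Icc (0:ℝ) 1 ×ˢ maynardCube n := by
    ext ⟨x, s⟩
    simp only [maynardCube, Set.mem_preimage, he₂_apply, Set.mem_pi, Set.mem_univ, true_implies, Set.mem_prod]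
    rw [Fin.forall_iff_succAbove m]
    simp only [Fin.insertNth_apply_same, Fin.insertNth_apply_succAbove]
  set I₀ : (Fin n → ℝ) → ℝ := fun t'' => ∫ u in Icc (0:ℝ) 1, F (Fin.insertNth m u t'') with hI₀
  have hinner : ∀ s : ℝ, ∫ t' in maynardCube (n + 1), F t' * F (Function.update t' m s) =
      ∫ t'' in maynardCube n, I₀ t'' * F (Fin.insertNth m s t'') := by
    intro s
    rw [← he₂.setIntegral_preimage_emb e₂.symm.measurableEmbedding, hpre₂]
    simp_rw [he₂_apply, Fin.update_insertNth]
    have hmeas : Measurable fun p : ℝ × (Fin n → ℝ) => F (Fin.insertNth m p.1 p.2) * F (Fin.insertNth m s p.2) := by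
      refine (hFm.comp ?_).mul (hFm.comp ?_)
      · exact (continuous_fst.finInsertNth m continuous_snd).measurable
      · exact (continuous_const.finInsertNth m continuous_snd).measurable
    have hint : IntegrableOn (fun p : ℝ × (Fin n → ℝ) => F (Fin.insertNth m p.1 p.2) * F (Fin.insertNth m s p.2))
        (Icc (0:ℝ) 1 ×ˢ maynardCube n) (volume.prod volume) := by
      rw [IntegrableOn, ← Measure.prod_restrict]
      exact Integrable.of_bound hmeas.aestronglyMeasurable (Gmax ^ 2) (ae_of_all _ fun p => by
        rw [Real.norm_eq_abs, abs_mul, sq]; exact mul_le_mul (hFb _) (hFb _) (abs_nonneg _) hGmax)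
    rw [setIntegral_prod _ hint]
    -- swap the order of integration
    have hsw := integral_integral_swap (μ := (volume : Measure ℝ).restrict (Icc (0:ℝ) 1))
      (ν := (volume : Measure (Fin n → ℝ)).restrict (maynardCube n))
      (f := fun u t'' => F (Fin.insertNth m u t'') * F (Fin.insertNth m s t'')) ?_
    · rw [hsw]
      refine integral_congr_ae (ae_of_all _ fun t'' => ?_)
      simp only [hI₀]
      rw [← integral_mul_const]
    · rw [Measure.prod_restrict]; exact hint
  simp_rw [hinner]
  -- Step 3: swap `s` and `t''`, and recognise `J`
  have hI₀m : Measurable I₀ := by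
    have hsm : StronglyMeasurable (fun p : ℝ × (Fin n → ℝ) => F (Fin.insertNth m p.1 p.2)) :=
      (hFm.comp (continuous_fst.finInsertNth m continuous_snd).measurable).stronglyMeasurable
    exact (hsm.integral_prod_left' (μ := (volume : Measure ℝ).restrict (Icc (0:ℝ) 1))).measurable
  have hmeas3 : Measurable fun p : ℝ × (Fin n → ℝ) => I₀ p.2 * F (Fin.insertNth m p.1 p.2) :=
    (hI₀m.comp measurable_snd).mul (hFm.comp (continuous_fst.finInsertNth m continuous_snd).measurable)
  have hI₀b : ∀ t'', |I₀ t''| ≤ Gmax := by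
    intro t''
    simp only [hI₀]
    have := norm_setIntegral_le_of_norm_le_const (μ := (volume : Measure ℝ)) (measure_Icc_lt_top (a := (0:ℝ)) (b := 1))
      (f := fun u => F (Fin.insertNth m u t'')) (C := Gmax) fun u _ => by rw [Real.norm_eq_abs]; exact hFb _
    rw [Real.norm_eq_abs, Measure.real, Real.volume_Icc, sub_zero, ENNReal.toReal_ofReal zero_le_one, mul_one] at this
    exact this
  have hint3 : Integrable (Function.uncurry fun s t'' => I₀ t'' * F (Fin.insertNth m s t''))
      (((volume : Measure ℝ).restrict (Icc (0:ℝ) 1)).prod ((volume : Measure (Fin n → ℝ)).restrict (maynardCube n))) := by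
    refine Integrable.of_bound hmeas3.aestronglyMeasurable (Gmax * Gmax) (ae_of_all _ fun p => ?_)
    rw [Real.norm_eq_abs]
    show |I₀ p.2 * F (Fin.insertNth m p.1 p.2)| ≤ Gmax * Gmax
    rw [abs_mul]; exact mul_le_mul (hI₀b _) (hFb _) (abs_nonneg _) hGmax
  rw [integral_integral_swap hint3]
  simp_rw [integral_const_mul]
  rw [maynardJ_succ_eq, Set.indicator_indicator, Set.inter_self]
  refine integral_congr_ae (ae_of_all _ fun t'' => ?_)
  simp only [hI₀]
  rw [intervalIntegral.integral_of_le zero_le_one, ← integral_Icc_eq_integral_Ioc, sq]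

/-- `∫_{[0,1]^{k+1}} Gtwo = J_k^{(m)}(F)` for `F = 1_{R_k} G`, `G` continuous (any `k`; `m : Fin k` forces
`k ≥ 1`). [cite: MaynardAnnals2015, Proposition 4.1 (definition of J_k^{(m)})] -/
theorem integral_cube_Gtwo {k : ℕ} (m : Fin k) {Gf : (Fin k → ℝ) → ℝ} (hG : Continuous Gf) :
    ∫ t in maynardCube (k + 1), Gtwo m ((maynardSimplex k).indicator Gf) t =
      maynardJ k m ((maynardSimplex k).indicator Gf) := by
  cases k with
  | zero => exact m.elim0
  | succ n => exact integral_cube_Gtwo_succ m hG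

end Integrals

/-! ### Upper bounds: `∑_A 1/φ(A)`, `∑_{good} goodW`, `λ_max` -/

section UpperBounds

variable {D₀ Rn : ℕ}

/-- `∑_{A ∈ tuples} 1/φ(A) ≤ M₁^k`, `M₁ = ∑_{v good} sfw₁(v)` (Maynard's factor
`(∑_{u<R, (u,W)=1} μ(u)²/φ(u))^k` in the proof of Lemma 5.1). [cite: MaynardAnnals2015, proof of Lemma 5.1 (the contribution of s_{i,j} > D₀)] -/
theorem sum_tuples_one_div_phiA_le :
    ∑ A ∈ tuples k D₀ Rn, 1 / phiA A ≤ (∑ v ∈ goodNat D₀ Rn, sfw (primorial D₀) wOne v) ^ k := by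
  rw [Finset.sum_congr rfl fun A hA => one_div_phiA_eq_prod_sfw hA]
  refine (sum_tuples_prod_le (fun _ => sfw (primorial D₀) wOne) fun i u _ => sfw_nonneg (fun p hp => wOne_nonneg hp) u).trans ?_
  rw [Finset.prod_const, Finset.card_univ, Fintype.card_fin]

/-- The same bound for the sum over the support tuples of level `R` (a sub-sum). [folklore] -/
theorem sum_tuplesProd_one_div_phiA_le :
    ∑ A ∈ tuplesProd k D₀ Rn, 1 / phiA A ≤ (∑ v ∈ goodNat D₀ Rn, sfw (primorial D₀) wOne v) ^ k :=
  (Finset.sum_le_sum_of_subset_of_nonneg tuplesProd_subset fun _ hA _ =>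
    (one_div_pos.2 (phiA_pos fun _ hx => prime_of_mem_tuples hA hx)).le).trans sum_tuples_one_div_phiA_le

/-- `∑_{good pairs} goodW ≤ ∏ᵢ M_{wvec i}` (reindex by `(k+1)`-tuples and drop the constraints). [folklore] -/
theorem sum_goodPairs_goodW_le (m : Fin k) :
    ∑ P ∈ goodPairs k D₀ Rn m, goodW m P ≤ ∏ i, ∑ v ∈ goodNat D₀ Rn, sfw (primorial D₀) (wvec m i) v := by
  have hw0 : ∀ i p, p.Prime → 0 ≤ wvec m i p := by
    intro i p hp
    refine Fin.lastCases ?_ (fun j => ?_) i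
    · simp only [wvec, Fin.snoc_last]; exact wOne_nonneg hp
    · simp only [wvec, Fin.snoc_castSucc]; split_ifs
      · exact wOne_nonneg hp
      · exact wTwo_nonneg hp
  rw [Finset.sum_congr rfl fun P hP => goodW_eq_prod_sfw hP,
    sum_goodPairs_eq_sum_imgU (fun u => ∏ i, sfw (primorial D₀) (wvec m i) (u i)), Finset.prod_univ_sum]
  refine Finset.sum_le_sum_of_subset_of_nonneg ?_ fun u _ _ => Finset.prod_nonneg fun i _ => sfw_nonneg (hw0 i) _
  exact (Finset.filter_subset _ _).trans (Finset.filter_subset _ _)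

/-- `(∏ dᵢ)/φ(∏ dᵢ) = ∑_{S ⊆ B} 1/φ(S) ≤ M₁^k` for a divisor tuple `B` (Maynard: "since
`d/φ(d) = ∑_{e ∣ d} 1/φ(e)` for square-free `d`", proof of Lemma 5.1). [cite: MaynardAnnals2015, proof of Lemma 5.1 (the bound for λ_max)] -/
theorem prodA_div_phiA_le_pow {B : Finset (ℕ × Fin k)} (hB : B ∈ tuples k D₀ Rn) :
    prodA B / phiA B ≤ (∑ v ∈ goodNat D₀ Rn, sfw (primorial D₀) wOne v) ^ k := by
  have hp : ∀ x ∈ B, x.1.Prime := fun x hx => prime_of_mem_tuples hB hx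
  have hid : prodA B / phiA B = ∑ S ∈ B.powerset, 1 / phiA S := by
    rw [prodA, phiA, ← Finset.prod_div_distrib]
    rw [Finset.prod_congr rfl fun x hx => show (x.1 : ℝ) / ((x.1 : ℝ) - 1) = 1 + 1 / ((x.1 : ℝ) - 1) by
      have : (2:ℝ) ≤ x.1 := by exact_mod_cast (hp x hx).two_le
      have hne : (x.1 : ℝ) - 1 ≠ 0 := by linarith
      field_simp; ring]
    rw [Finset.prod_one_add]
    refine Finset.sum_congr rfl fun S _ => ?_
    rw [phiA, one_div, ← Finset.prod_inv_distrib]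
    exact Finset.prod_congr rfl fun x _ => by rw [one_div]
  rw [hid]
  calc ∑ S ∈ B.powerset, 1 / phiA S ≤ ∑ S ∈ tuples k D₀ Rn, 1 / phiA S :=
        Finset.sum_le_sum_of_subset_of_nonneg (fun S hS => subset_mem_tuples hB (Finset.mem_powerset.1 hS))
          fun S hS _ => (one_div_pos.2 (phiA_pos fun x hx => prime_of_mem_tuples hS hx)).le
    _ ≤ _ := sum_tuples_one_div_phiA_le

/-- **`λ_max ≤ y_max M₁^{2k}`** (Maynard 2015, proof of Lemma 5.1: `λ_max ≪ y_max (log R)^k`; here in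
the cruder form with `(∏dᵢ)/φ(∏dᵢ) ≤ M₁^k` in place of `τ_k`). [cite: MaynardAnnals2015, proof of Lemma 5.1 (the bound λ_max ≪ y_max (log R)^k)] -/
theorem abs_lam_le_pow {y : Finset (ℕ × Fin k) → ℝ} {Y : ℝ} (hY0 : 0 ≤ Y) (hY : ∀ A ∈ tuplesProd k D₀ Rn, |y A| ≤ Y)
    (B : Finset (ℕ × Fin k)) :
    |lam D₀ Rn y B| ≤ Y * (∑ v ∈ goodNat D₀ Rn, sfw (primorial D₀) wOne v) ^ (2 * k) := by
  set M₁ := ∑ v ∈ goodNat D₀ Rn, sfw (primorial D₀) wOne v with hM₁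
  have hM₁0 : 0 ≤ M₁ := Finset.sum_nonneg fun v _ => sfw_nonneg (fun p hp => wOne_nonneg hp) v
  by_cases hne : ((tuplesProd k D₀ Rn).filter (fun A => B ⊆ A)).Nonempty
  swap
  · rw [Finset.not_nonempty_iff_eq_empty] at hne
    rw [lam, hne, Finset.sum_empty, mul_zero, abs_zero]; positivity
  obtain ⟨A₀, hA₀⟩ := hne
  obtain ⟨hA₀T, hBA₀⟩ := Finset.mem_filter.1 hA₀
  have hBT : B ∈ tuplesProd k D₀ Rn := subset_mem_tuplesProd hA₀T hBA₀
  have hBt := tuplesProd_subset hBT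
  have hpB : ∀ x ∈ B, x.1.Prime := fun x hx => prime_of_mem_tuples hBt hx
  have hφB := phiA_pos hpB
  have hprodB : 0 ≤ prodA B := Finset.prod_nonneg fun x _ => by positivity
  rw [lam, abs_mul, abs_mul, abs_pow, abs_neg, abs_one, one_pow, one_mul, abs_of_nonneg hprodB]
  -- `|∑ y_A/φ(A)| ≤ Y ∑ 1/φ(A)` and `φ(A) = φ(B) φ(A∖B)`
  have h1 : |∑ A ∈ (tuplesProd k D₀ Rn).filter (fun A => B ⊆ A), y A / phiA A| ≤
      Y * (1 / phiA B) * ∑ A ∈ (tuplesProd k D₀ Rn).filter (fun A => B ⊆ A), 1 / phiA (A \ B) := by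
    rw [Finset.mul_sum]
    refine (Finset.abs_sum_le_sum_abs _ _).trans (Finset.sum_le_sum fun A hA => ?_)
    obtain ⟨hAT, hBA⟩ := Finset.mem_filter.1 hA
    have hpA : ∀ x ∈ A, x.1.Prime := fun x hx => prime_of_mem_tuples (tuplesProd_subset hAT) hx
    have hφ : phiA A = phiA B * phiA (A \ B) := by
      rw [← phiA_union Finset.disjoint_sdiff, Finset.union_sdiff_of_subset hBA]
    have hφD := phiA_pos (A := A \ B) fun x hx => hpA x (Finset.sdiff_subset hx)
    rw [abs_div, abs_of_pos (phiA_pos hpA), hφ, div_le_iff₀ (mul_pos hφB hφD)]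
    calc |y A| ≤ Y := hY A hAT
      _ = Y * (1 / phiA B) * (1 / phiA (A \ B)) * (phiA B * phiA (A \ B)) := by field_simp
  have h2 : ∑ A ∈ (tuplesProd k D₀ Rn).filter (fun A => B ⊆ A), 1 / phiA (A \ B) ≤ M₁ ^ k := by
    calc _ ≤ ∑ A' ∈ tuples k D₀ Rn, 1 / phiA A' := by
          rw [← Finset.sum_image (f := fun A' => 1 / phiA A') (s := (tuplesProd k D₀ Rn).filter (fun A => B ⊆ A))
            (g := fun A => A \ B) ?_]
          · refine Finset.sum_le_sum_of_subset_of_nonneg (fun A' hA' => ?_) fun A' hA' _ =>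
              (one_div_pos.2 (phiA_pos fun x hx => prime_of_mem_tuples hA' hx)).le
            obtain ⟨A, hA, rfl⟩ := Finset.mem_image.1 hA'
            exact subset_mem_tuples (tuplesProd_subset (Finset.mem_filter.1 hA).1) Finset.sdiff_subset
          · intro A hA A' hA' h
            have hBA := (Finset.mem_filter.1 hA).2
            have hBA' := (Finset.mem_filter.1 hA').2
            rw [← Finset.sdiff_union_of_subset hBA, ← Finset.sdiff_union_of_subset hBA']
            simp only at h; rw [h]
      _ ≤ M₁ ^ k := sum_tuples_one_div_phiA_le
  have h3 : prodA B * (1 / phiA B) ≤ M₁ ^ k := by rw [← div_eq_mul_one_div]; exact prodA_div_phiA_le_pow hBt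
  calc prodA B * |∑ A ∈ (tuplesProd k D₀ Rn).filter (fun A => B ⊆ A), y A / phiA A|
      ≤ prodA B * (Y * (1 / phiA B) * M₁ ^ k) := by
        refine mul_le_mul_of_nonneg_left (h1.trans ?_) hprodB
        exact mul_le_mul_of_nonneg_left h2 (by positivity)
    _ = Y * (prodA B * (1 / phiA B)) * M₁ ^ k := by ring
    _ ≤ Y * M₁ ^ k * M₁ ^ k := by gcongr
    _ = Y * M₁ ^ (2 * k) := by rw [two_mul, pow_add]; ring

/-- The mass `M_w = ∑_{v good} sfw_w(v)` equals the counting function at `R`. [folklore] -/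
theorem sum_goodNat_sfw_eq_massUpTo (w : ℕ → ℝ) :
    ∑ v ∈ goodNat D₀ Rn, sfw (primorial D₀) w v = massUpTo (sfw (primorial D₀) w) Rn := by
  rw [massUpTo]
  exact Finset.sum_subset (fun v hv => (mem_goodNat_iff.1 hv).1) fun v hv hv' => sfw_eq_zero_of_not_mem_goodNat w hv hv'

end UpperBounds

/-! ### The error terms of `S₂^{(m)}`: reduction to the prime-counting discrepancy -/

section ErrTwo

variable {D₀ Rn N : ℕ} {v₀ : ℤ} {h : Fin k → ℤ}

/-- The prime-counting discrepancy `max_{1 ≤ y ≤ x} max_{(a,q)=1} |π(⌊y⌋; q, a) − π(⌊y⌋)/φ(q)|`, the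
summand of `PrimesHaveLevelPi`. [folklore] -/
noncomputable def piDisc (x : ℝ) (q : ℕ) : ℝ :=
  ⨆ y : Set.Icc 1 x, ⨆ a : (ZMod q)ˣ,
    |(LevelOfDistribution.primeCountingMod q (a : ZMod q).val ⌊(y : ℝ)⌋₊ : ℝ) - (Nat.primeCounting ⌊(y : ℝ)⌋₊ : ℝ) / Nat.totient q|

/-- `π(n; q, a) ≤ n + 1` (crude). [folklore] -/
theorem primeCountingMod_le_succ (q a n : ℕ) : LevelOfDistribution.primeCountingMod q a n ≤ n + 1 := by
  rw [LevelOfDistribution.primeCountingMod]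
  exact (Finset.card_filter_le _ _).trans (Finset.card_range _).le

/-- `π(n) ≤ n`, cast to `ℝ` (the `ℕ` form is `Literature.NumberTheory.Sieve.BFIReduction.primeCounting_le_self` in
`BombieriFriedlanderIwaniecProofs.lean`, not imported here to keep the import graph of the sieve files
small). [folklore] -/
theorem cast_primeCounting_le_self (n : ℕ) : (Nat.primeCounting n : ℝ) ≤ n := by
  have h : Nat.primeCounting n ≤ n := by
    rw [← Nat.primesLE_card_eq_primeCounting, Nat.primesLE_eq_filter_Icc_one]
    exact (Finset.card_filter_le _ _).trans (by simp)
  exact_mod_cast h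

/-- A single discrepancy is at most `piDisc`. [folklore] -/
theorem abs_sub_le_piDisc {q : ℕ} (hq : q ≠ 0) {x : ℝ} {n : ℕ} (hn1 : 1 ≤ n) (hnx : (n : ℝ) ≤ x) (u : (ZMod q)ˣ) :
    |(LevelOfDistribution.primeCountingMod q (u : ZMod q).val n : ℝ) - (Nat.primeCounting n : ℝ) / Nat.totient q| ≤ piDisc x q := by
  haveI : NeZero q := ⟨hq⟩
  set f : Set.Icc (1:ℝ) x → ℝ := fun y => ⨆ a : (ZMod q)ˣ,
    |(LevelOfDistribution.primeCountingMod q (a : ZMod q).val ⌊(y : ℝ)⌋₊ : ℝ) - (Nat.primeCounting ⌊(y : ℝ)⌋₊ : ℝ) / Nat.totient q| with hf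
  have hbound : ∀ (y : Set.Icc (1:ℝ) x) (a : (ZMod q)ˣ),
      |(LevelOfDistribution.primeCountingMod q (a : ZMod q).val ⌊(y : ℝ)⌋₊ : ℝ) - (Nat.primeCounting ⌊(y : ℝ)⌋₊ : ℝ) / Nat.totient q| ≤ 3 * x + 1 := by
    intro y a
    have hy1 : (1:ℝ) ≤ y := y.2.1
    have hyx : (y : ℝ) ≤ x := y.2.2
    have hfl : (⌊(y:ℝ)⌋₊ : ℝ) ≤ x := (Nat.floor_le (by linarith)).trans hyx
    have h1 : (LevelOfDistribution.primeCountingMod q (a : ZMod q).val ⌊(y : ℝ)⌋₊ : ℝ) ≤ x + 1 := by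
      have := primeCountingMod_le_succ q (a : ZMod q).val ⌊(y : ℝ)⌋₊
      calc (LevelOfDistribution.primeCountingMod q (a : ZMod q).val ⌊(y : ℝ)⌋₊ : ℝ) ≤ ⌊(y:ℝ)⌋₊ + 1 := by exact_mod_cast this
        _ ≤ x + 1 := by linarith
    have h2 : (Nat.primeCounting ⌊(y : ℝ)⌋₊ : ℝ) / Nat.totient q ≤ x := by
      have hφ : (1:ℝ) ≤ Nat.totient q := by exact_mod_cast Nat.totient_pos.2 (Nat.pos_of_ne_zero hq)
      have : (Nat.primeCounting ⌊(y : ℝ)⌋₊ : ℝ) ≤ ⌊(y:ℝ)⌋₊ := cast_primeCounting_le_self _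
      exact (div_le_self (Nat.cast_nonneg _) hφ).trans (this.trans hfl)
    rw [abs_le]; constructor <;> nlinarith [Nat.cast_nonneg (α := ℝ) (LevelOfDistribution.primeCountingMod q (a : ZMod q).val ⌊(y : ℝ)⌋₊),
      div_nonneg (Nat.cast_nonneg (α := ℝ) (Nat.primeCounting ⌊(y : ℝ)⌋₊)) (Nat.cast_nonneg (α := ℝ) (Nat.totient q))]
  have hbdd : BddAbove (Set.range f) := by
    refine ⟨3 * x + 1, ?_⟩
    rintro _ ⟨y, rfl⟩
    exact ciSup_le fun a => hbound y a
  have hnx1 : (1:ℝ) ≤ x := le_trans (by exact_mod_cast hn1) hnx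
  let y : Set.Icc (1:ℝ) x := ⟨n, by exact_mod_cast hn1, hnx⟩
  have hfloor : ⌊((y : Set.Icc (1:ℝ) x) : ℝ)⌋₊ = n := by simp [y]
  calc _ = |(LevelOfDistribution.primeCountingMod q (u : ZMod q).val ⌊((y : Set.Icc (1:ℝ) x) : ℝ)⌋₊ : ℝ) -
        (Nat.primeCounting ⌊((y : Set.Icc (1:ℝ) x) : ℝ)⌋₊ : ℝ) / Nat.totient q| := by rw [hfloor]
    _ ≤ f y := le_ciSup (f := fun a : (ZMod q)ˣ => |(LevelOfDistribution.primeCountingMod q (a : ZMod q).val ⌊((y : Set.Icc (1:ℝ) x) : ℝ)⌋₊ : ℝ) -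
        (Nat.primeCounting ⌊((y : Set.Icc (1:ℝ) x) : ℝ)⌋₊ : ℝ) / Nat.totient q|) (Finite.bddAbove_range _) u
    _ ≤ piDisc x q := le_ciSup hbdd y

/-- `Δ_π(x; q) ≥ 0`. [folklore] -/
theorem piDisc_nonneg (x : ℝ) (q : ℕ) : 0 ≤ piDisc x q := by
  rw [piDisc]
  exact Real.iSup_nonneg fun y => Real.iSup_nonneg fun a => abs_nonneg _

/-- `π(n; q, b) − π(l; q, b)` counts the primes `p ≡ b (q)` in `(l, n]`. [folklore] -/
theorem primeCountingMod_sub_eq (q b : ℕ) {l n : ℕ} (hln : l ≤ n) :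
    LevelOfDistribution.primeCountingMod q b n - LevelOfDistribution.primeCountingMod q b l =
      ((Finset.Ioc l n).filter (fun p => p.Prime ∧ p ≡ b [MOD q])).card := by
  rw [LevelOfDistribution.primeCountingMod, LevelOfDistribution.primeCountingMod]
  have hsub : (Finset.range (l + 1)).filter (fun p => p.Prime ∧ p ≡ b [MOD q]) ⊆
      (Finset.range (n + 1)).filter (fun p => p.Prime ∧ p ≡ b [MOD q]) :=
    Finset.filter_subset_filter _ (Finset.range_mono (by omega))
  rw [← Finset.card_sdiff_of_subset hsub]
  congr 1
  ext p
  simp only [Finset.mem_sdiff, Finset.mem_filter, Finset.mem_range, Finset.mem_Ioc]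
  constructor
  · rintro ⟨⟨h1, h2⟩, h3⟩
    refine ⟨⟨?_, by omega⟩, h2⟩
    by_contra hle; push Not at hle
    exact h3 ⟨by omega, h2⟩
  · rintro ⟨⟨h1, h2⟩, h3⟩
    exact ⟨⟨by omega, h3⟩, fun ⟨h4, _⟩ => by omega⟩

/-- `π(n) − π(l)` counts the primes in `(l, n]`. [folklore] -/
theorem primeCounting_sub_eq {l n : ℕ} (hln : l ≤ n) :
    Nat.primeCounting n - Nat.primeCounting l = ((Finset.Ioc l n).filter Nat.Prime).card := by
  rw [← Nat.primesLE_card_eq_primeCounting, ← Nat.primesLE_card_eq_primeCounting, Nat.primesLE_eq_filter_Icc_one,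
    Nat.primesLE_eq_filter_Icc_one]
  have hsub : (Finset.Icc 1 l).filter Nat.Prime ⊆ (Finset.Icc 1 n).filter Nat.Prime :=
    Finset.filter_subset_filter _ (Finset.Icc_subset_Icc_right hln)
  rw [← Finset.card_sdiff_of_subset hsub]
  congr 1
  ext p
  simp only [Finset.mem_sdiff, Finset.mem_filter, Finset.mem_Icc, Finset.mem_Ioc]
  constructor
  · rintro ⟨⟨h1, h2⟩, h3⟩
    refine ⟨⟨?_, h1.2⟩, h2⟩
    by_contra hle; push Not at hle
    exact h3 ⟨⟨h1.1, hle⟩, h2⟩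
  · rintro ⟨⟨h1, h2⟩, h3⟩
    exact ⟨⟨⟨by have := h3.one_lt; omega, h2⟩, h3⟩, fun ⟨h4, _⟩ => by omega⟩

/-- **The count of Lemma 5.2 as a difference of `π(·; Wq, b)`**: for a compatible pair with
`d_m = e_m = 1`, combined residue `a (mod Wq)`, and `N + h_m ≥ 1`,
`#{N ≤ n < 2N : n ≡ a (Wq), n + h_m prime} = π(2N+h_m−1; Wq, b) − π(N+h_m−1; Wq, b)`,
`b = a + h_m mod Wq`. [cite: MaynardAnnals2015, proof of Lemma 5.2 (the inner sum over a single residue class modulo q)] -/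
theorem card_filter_modEq_isPrimeAt_eq (m : Fin k) {M : ℕ} (hM : 0 < M) (a : ℤ) (hN : 1 ≤ (N : ℤ) + h m) :
    (((Finset.Ico (N : ℤ) (2 * N)).filter (fun n => n ≡ a [ZMOD M] ∧ IsPrimeAt h m n)).card : ℤ) =
      (LevelOfDistribution.primeCountingMod M (((a + h m) % M).toNat) ((2 * N : ℤ) + h m - 1).toNat : ℤ) -
        LevelOfDistribution.primeCountingMod M (((a + h m) % M).toNat) (((N : ℤ) + h m - 1).toNat) := by
  set b := ((a + h m) % M).toNat with hb
  set U' := ((2 * N : ℤ) + h m - 1).toNat with hU'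
  set L' := (((N : ℤ) + h m - 1).toNat) with hL'
  have hM' : (0:ℤ) < M := by exact_mod_cast hM
  have hbmod : (b : ℤ) = (a + h m) % M := by rw [hb, Int.toNat_of_nonneg (Int.emod_nonneg _ hM'.ne')]
  have hL'v : (L' : ℤ) = N + h m - 1 := by rw [hL', Int.toNat_of_nonneg (by omega)]
  have hU'v : (U' : ℤ) = 2 * N + h m - 1 := by rw [hU', Int.toNat_of_nonneg (by omega)]
  have hLU : L' ≤ U' := by omega
  rw [← Nat.cast_sub (by
    rw [LevelOfDistribution.primeCountingMod, LevelOfDistribution.primeCountingMod]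
    exact Finset.card_le_card (Finset.filter_subset_filter _ (Finset.range_mono (by omega)))),
    primeCountingMod_sub_eq M b hLU]
  -- bijection `n ↦ (n + h_m).toNat`
  rw [Nat.cast_inj]
  refine Finset.card_nbij' (fun n => (n + h m).toNat) (fun p => (p : ℤ) - h m) (fun n hn => ?_) (fun p hp => ?_)
    (fun n hn => ?_) (fun p hp => ?_)
  · rw [Finset.mem_coe, Finset.mem_filter, Finset.mem_Ico] at hn
    obtain ⟨⟨h1, h2⟩, hmod, hpos, hprime⟩ := hn
    rw [Finset.mem_coe, Finset.mem_filter, Finset.mem_Ioc]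
    have hv : (((n + h m).toNat : ℕ) : ℤ) = n + h m := Int.toNat_of_nonneg hpos.le
    refine ⟨⟨?_, ?_⟩, hprime, ?_⟩
    · zify; rw [hv, hL'v]; omega
    · zify; rw [hv, hU'v]; omega
    · rw [← Int.natCast_modEq_iff, hv, hbmod]
      exact (Int.ModEq.add_right (h m) hmod).trans (Int.mod_modEq _ _).symm
  · rw [Finset.mem_coe, Finset.mem_filter, Finset.mem_Ioc] at hp
    obtain ⟨⟨h1, h2⟩, hprime, hmod⟩ := hp
    rw [Finset.mem_coe, Finset.mem_filter, Finset.mem_Ico]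
    have hl : (L' : ℤ) < p := by exact_mod_cast h1
    have hu : (p : ℤ) ≤ U' := by exact_mod_cast h2
    rw [hL'v] at hl; rw [hU'v] at hu
    refine ⟨⟨?_, ?_⟩, ?_, ?_, ?_⟩
    · show (N : ℤ) ≤ (p : ℤ) - h m; omega
    · show (p : ℤ) - h m < 2 * N; omega
    · show (p : ℤ) - h m ≡ a [ZMOD M]
      rw [← Int.natCast_modEq_iff, hbmod] at hmod
      have := hmod.trans (Int.mod_modEq _ _)
      have := Int.ModEq.sub_right (h m) this
      simpa using this
    · show 0 < (p : ℤ) - h m + h m; omega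
    · show ((p : ℤ) - h m + h m).toNat.Prime
      simpa using hprime
  · rw [Finset.mem_coe, Finset.mem_filter] at hn
    have hpos := hn.2.2.1
    simp only
    rw [Int.toNat_of_nonneg hpos.le]; ring
  · simp

end ErrTwo

/-! ### The pointwise bound `|E(d, e)| ≤ 2 Δ_π(x; W[d,e])` -/

section ErrTwoBound

variable {D₀ Rn N : ℕ} {v₀ : ℤ} {h : Fin k → ℤ}

/-- `φ(W ∏_{p ∈ U} p) = φ(W) ∏_{p ∈ U} (p − 1)` for distinct primes `p ∤ W`. [folklore] -/
theorem totient_mul_prod_primes (W : ℕ) (U : Finset ℕ) (hU : ∀ p ∈ U, p.Prime) (hUW : ∀ p ∈ U, ¬p ∣ W) :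
    ((W * ∏ p ∈ U, p).totient : ℝ) = (W.totient : ℝ) * ∏ p ∈ U, ((p : ℝ) - 1) := by
  classical
  induction U using Finset.induction_on with
  | empty => simp
  | insert q U hq ih =>
    have hqP : q.Prime := hU q (Finset.mem_insert_self q U)
    have hU' : ∀ p ∈ U, p.Prime := fun p hp => hU p (Finset.mem_insert_of_mem hp)
    have hUW' : ∀ p ∈ U, ¬p ∣ W := fun p hp => hUW p (Finset.mem_insert_of_mem hp)
    have hcop : (W * ∏ p ∈ U, p).Coprime q := by
      rw [Nat.Coprime, Nat.gcd_comm, ← Nat.Coprime, Nat.Prime.coprime_iff_not_dvd hqP]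
      intro hdvd
      rcases (Nat.Prime.dvd_mul hqP).1 hdvd with h1 | h1
      · exact hUW q (Finset.mem_insert_self q U) h1
      · obtain ⟨p, hp, hqp⟩ := (Prime.dvd_finsetProd_iff hqP.prime _).1 h1
        have := (Nat.prime_dvd_prime_iff_eq hqP (hU' p hp)).1 hqp
        exact hq (this ▸ hp)
    rw [Finset.prod_insert hq, Finset.prod_insert hq, mul_left_comm, Nat.totient_mul (Nat.coprime_comm.1 hcop),
      Nat.totient_prime hqP, Nat.cast_mul, ih hU' hUW', Nat.cast_sub hqP.one_le]
    push_cast; ring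

/-- **`|E(d,e)| ≤ 2 Δ_π`** (Maynard 2015, proof of Lemma 5.2: "the inner sum will contribute
`X_N/φ(q) + O(E(N,q))`"): for a compatible pair of divisor tuples with
`d_m = e_m = 1`, residue `v₀` with `(v₀ + hᵢ, W) = 1`, distinct shifts of diameter `≤ D₀`, `N + h_m ≥ 2`
and `x ≥ 2N + h_m − 1`, the discrepancy `err2` with `X = π(2N+h_m−1) − π(N+h_m−1)` is at most twice the
prime-counting discrepancy to modulus `W ∏_{p ∣ [d,e]} p`. [cite: MaynardAnnals2015, proof of Lemma 5.2 (definition of E(N, q) and the display following it)] -/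
theorem abs_err2_le (hh : ShiftHyp k D₀ h) (hv₀ : ∀ i, Int.gcd (v₀ + h i) (primorial D₀) = 1) (m : Fin k)
    {B C : Finset (ℕ × Fin k)} (hB : B ∈ tuplesOff k D₀ Rn m) (hC : C ∈ tuplesOff k D₀ Rn m)
    (hBC : IsFunctional (B ∪ C)) (hN : 2 ≤ (N : ℤ) + h m) {x : ℝ} (hx : (((2 * N : ℤ) + h m - 1 : ℤ) : ℝ) ≤ x) :
    |err2 D₀ N v₀ h m ((Nat.primeCounting ((2 * N : ℤ) + h m - 1).toNat : ℝ) -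
        Nat.primeCounting (((N : ℤ) + h m - 1).toNat)) B C| ≤
      2 * piDisc x (primorial D₀ * ∏ p ∈ (B ∪ C).image Prod.fst, p) := by
  obtain ⟨hBT, hBm⟩ := mem_tuplesOff.1 hB
  obtain ⟨hCT, hCm⟩ := mem_tuplesOff.1 hC
  set W := primorial D₀ with hW
  set U := (B ∪ C).image Prod.fst with hU
  have hUp : ∀ p ∈ U, p.Prime := fun p hp => by
    obtain ⟨y, hy, rfl⟩ := Finset.mem_image.1 hp
    exact (Finset.mem_union.1 hy).elim (fun hy => prime_of_mem_tuples (tuplesProd_subset hBT) hy)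
      (fun hy => prime_of_mem_tuples (tuplesProd_subset hCT) hy)
  have hUlt : ∀ y ∈ B ∪ C, D₀ < y.1 := fun y hy => (Finset.mem_union.1 hy).elim
    (fun hy => lt_of_mem_tuples (tuplesProd_subset hBT) hy) (fun hy => lt_of_mem_tuples (tuplesProd_subset hCT) hy)
  have hUW : ∀ p ∈ U, ¬p ∣ W := fun p hp => by
    obtain ⟨y, hy, rfl⟩ := Finset.mem_image.1 hp
    rw [hW, (hUp y.1 hp).dvd_primorial_iff]
    have := hUlt y hy; omega
  obtain ⟨a, ha⟩ := exists_forall_modEq_iff W U hUp hUW (targetRes h (B ∪ C)) v₀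
  set M := W * ∏ p ∈ U, p with hM
  have hM0 : 0 < M := Nat.mul_pos (primorial_pos D₀) (Finset.prod_pos fun p hp => (hUp p hp).pos)
  -- the counted set as a residue class with the primality condition
  have hset : (sieveRange W N v₀).filter (fun n => IsPrimeAt h m n ∧ (Divides h B n ∧ Divides h C n)) =
      (Finset.Ico (N : ℤ) (2 * N)).filter (fun n => n ≡ a [ZMOD M] ∧ IsPrimeAt h m n) := by
    ext n
    simp only [sieveRange, Finset.mem_filter, and_assoc]
    rw [← ha n, ← divides_union_iff hBC n]
    constructor
    · rintro ⟨h1, h2, h3, h4, h5⟩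
      exact ⟨h1, ⟨h2, fun y hy => (Finset.mem_union.1 hy).elim (h4 y) (h5 y)⟩, h3⟩
    · rintro ⟨h1, ⟨h2, h3⟩, h4⟩
      exact ⟨h1, h2, h4, fun y hy => h3 y (Finset.mem_union_left _ hy), fun y hy => h3 y (Finset.mem_union_right _ hy)⟩
  have hcnt : (cnt2 W N v₀ h m B C : ℝ) =
      (LevelOfDistribution.primeCountingMod M (((a + h m) % M).toNat) ((2 * N : ℤ) + h m - 1).toNat : ℝ) -
        LevelOfDistribution.primeCountingMod M (((a + h m) % M).toNat) (((N : ℤ) + h m - 1).toNat) := by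
    have := card_filter_modEq_isPrimeAt_eq (h := h) (N := N) m hM0 a (by omega)
    rw [cnt2, hset]
    exact_mod_cast this
  -- the residue `b = a + h_m` is a unit modulo `M`
  set b := ((a + h m) % M).toNat with hb
  have hM' : (0:ℤ) < M := by exact_mod_cast hM0
  have hbmod : (b : ℤ) = (a + h m) % M := by rw [hb, Int.toNat_of_nonneg (Int.emod_nonneg _ hM'.ne')]
  have hblt : b < M := by zify; rw [hbmod]; exact Int.emod_lt_of_pos _ hM'
  have haa := (ha a).2 (Int.ModEq.refl a)
  have hbcop : b.Coprime M := by
    rw [hM]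
    refine Nat.Coprime.mul_right ?_ (Nat.Coprime.prod_right fun p hp => ?_)
    · -- modulo `W`: `b ≡ v₀ + h_m`, and `(v₀ + h_m, W) = 1`
      have h1 : (b : ℤ) ≡ v₀ + h m [ZMOD W] := by
        rw [hbmod]
        have hWM : (W : ℤ) ∣ M := by rw [hM]; exact_mod_cast dvd_mul_right W _
        exact ((Int.mod_modEq _ _).of_dvd hWM).trans (Int.ModEq.add_right _ (haa.1.of_dvd (dvd_refl _)))
      refine Nat.coprime_of_dvd fun p hp hpb hpW => ?_
      have hdiff : (p : ℤ) ∣ v₀ + h m := by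
        have := (Int.ModEq.dvd h1.symm)  -- `W ∣ (v₀ + h_m) - b`? orientation: a ≡ b → n ∣ b - a
        -- `h1.symm : v₀ + h m ≡ b`, `.dvd : W ∣ b - (v₀ + h m)`
        have hpd : (p : ℤ) ∣ (b : ℤ) - (v₀ + h m) := (Int.natCast_dvd_natCast.2 hpW).trans this
        have hpb' : (p : ℤ) ∣ (b : ℤ) := Int.natCast_dvd_natCast.2 hpb
        have := dvd_sub hpb' hpd
        simpa using this
      have hg : (p : ℤ) ∣ (Int.gcd (v₀ + h m) W : ℤ) := Int.dvd_coe_gcd hdiff (by exact_mod_cast hpW)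
      rw [hv₀ m] at hg
      exact hp.one_lt.ne' (by exact_mod_cast Int.eq_one_of_dvd_one (by positivity) hg)
    · -- modulo `p ∈ U`: `b ≡ h_m − h_i` with `0 < |h_m − h_i| ≤ D₀ < p`
      obtain ⟨y, hy, rfl⟩ := Finset.mem_image.1 hp
      have hyP := hUp y.1 hp
      have hres := haa.2 y.1 hp
      rw [targetRes_eq_neg hBC hy] at hres
      have hym : y.2 ≠ m := (Finset.mem_union.1 hy).elim (hBm y) (hCm y)
      have h1 : (b : ℤ) ≡ h m - h y.2 [ZMOD y.1] := by
        rw [hbmod]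
        have hpM : ((y.1 : ℕ) : ℤ) ∣ M := by
          rw [hM]; exact_mod_cast (Finset.dvd_prod_of_mem _ hp).trans (dvd_mul_left _ W)
        have := ((Int.mod_modEq _ _).of_dvd hpM).trans (Int.ModEq.add_right (h m) hres)
        rwa [show -h y.2 + h m = h m - h y.2 by ring] at this
      rw [Nat.coprime_comm, Nat.Prime.coprime_iff_not_dvd hyP]
      intro hpb
      have hpd : ((y.1 : ℕ) : ℤ) ∣ h m - h y.2 := by
        have hd := h1.dvd  -- `p ∣ (h m - h y.2) - b`
        have hpb' : ((y.1 : ℕ) : ℤ) ∣ (b : ℤ) := Int.natCast_dvd_natCast.2 hpb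
        have := dvd_add hd hpb'
        simpa using this
      have hne : h m - h y.2 ≠ 0 := sub_ne_zero.2 fun e => hym (hh.inj e).symm
      have hle := Int.le_of_dvd (abs_pos.2 hne) ((dvd_abs _ _).2 hpd)
      have hdiam := hh.diam m y.2
      have hlt := hUlt y hy
      omega
  -- the unit of `ZMod M` with value `b`
  haveI : NeZero M := ⟨hM0.ne'⟩
  set u : (ZMod M)ˣ := ZMod.unitOfCoprime b hbcop with hu
  have huval : ((u : ZMod M)).val = b := by
    rw [hu, ZMod.coe_unitOfCoprime, ZMod.val_natCast, Nat.mod_eq_of_lt hblt]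
  -- assemble
  set U' := ((2 * N : ℤ) + h m - 1).toNat with hU'
  set L' := (((N : ℤ) + h m - 1).toNat) with hL'
  have hL'1 : 1 ≤ L' := by rw [hL']; omega
  have hU'1 : 1 ≤ U' := by rw [hU']; omega
  have hL'x : (L' : ℝ) ≤ x := by
    refine le_trans ?_ hx
    have : (L' : ℤ) ≤ (2 * N : ℤ) + h m - 1 := by rw [hL', Int.toNat_of_nonneg (by omega)]; omega
    exact_mod_cast this
  have hU'x : (U' : ℝ) ≤ x := by
    refine le_trans ?_ hx
    have : (U' : ℤ) ≤ (2 * N : ℤ) + h m - 1 := by rw [hU', Int.toNat_of_nonneg (by omega)]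
    exact_mod_cast this
  have hφ : ((W.totient : ℝ) * ∏ p ∈ U, ((p : ℝ) - 1)) = (M.totient : ℝ) := by
    rw [hM, totient_mul_prod_primes W U hUp hUW]
  have e1 := abs_sub_le_piDisc hM0.ne' hU'1 hU'x u
  have e2 := abs_sub_le_piDisc hM0.ne' hL'1 hL'x u
  rw [huval] at e1 e2
  rw [err2, hcnt, hφ, sub_div]
  calc _ = |((LevelOfDistribution.primeCountingMod M b U' : ℝ) - (Nat.primeCounting U' : ℝ) / M.totient) -
        ((LevelOfDistribution.primeCountingMod M b L' : ℝ) - (Nat.primeCounting L' : ℝ) / M.totient)| := by ring_nf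
    _ ≤ |(LevelOfDistribution.primeCountingMod M b U' : ℝ) - (Nat.primeCounting U' : ℝ) / M.totient| +
        |(LevelOfDistribution.primeCountingMod M b L' : ℝ) - (Nat.primeCounting L' : ℝ) / M.totient| := abs_sub _ _
    _ ≤ piDisc x M + piDisc x M := add_le_add e1 e2
    _ = 2 * piDisc x M := by ring

end ErrTwoBound

/-! ### Summing the error terms over pairs: reduction to distinct moduli -/

section PairSum

variable {D₀ Rn : ℕ}

/-- A union of two divisor tuples of level `R` is a divisor tuple of level `R²`. [folklore] -/
theorem union_mem_tuplesProd_sq {B C : Finset (ℕ × Fin k)} (hB : B ∈ tuplesProd k D₀ Rn) (hC : C ∈ tuplesProd k D₀ Rn)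
    (hBC : IsFunctional (B ∪ C)) : B ∪ C ∈ tuplesProd k D₀ (Rn * Rn) := by
  rw [mem_tuplesProd_iff] at hB hC ⊢
  refine ⟨fun x hx => ?_, hBC, ?_⟩
  · have hx' : x.1 ∈ primesIoc D₀ Rn := (Finset.mem_union.1 hx).elim (hB.1 x) (hC.1 x)
    rw [mem_primesIoc] at hx' ⊢
    refine ⟨⟨hx'.1.1, hx'.1.2.trans (Nat.le_mul_self Rn)⟩, hx'.2⟩
  · have h1 : ∀ x ∈ B ∩ C, 1 ≤ x.1 := fun x hx => (mem_primesIoc.1 (hB.1 x (Finset.mem_inter.1 hx).1)).2.one_lt.le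
    have key := Finset.prod_union_inter (s₁ := B) (s₂ := C) (f := fun x => x.1)
    have h2 : 1 ≤ ∏ x ∈ B ∩ C, x.1 :=
      Finset.prod_induction _ (fun n => 1 ≤ n) (fun a b ha hb => Nat.one_le_iff_ne_zero.2 (Nat.mul_ne_zero
        (Nat.one_le_iff_ne_zero.1 ha) (Nat.one_le_iff_ne_zero.1 hb))) le_rfl h1
    calc ∏ x ∈ B ∪ C, x.1 ≤ (∏ x ∈ B ∪ C, x.1) * ∏ x ∈ B ∩ C, x.1 := Nat.le_mul_of_pos_right _ h2
      _ = (∏ x ∈ B, x.1) * ∏ x ∈ C, x.1 := key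
      _ ≤ Rn * Rn := Nat.mul_le_mul hB.2.2 hC.2.2

/-- **From pairs to unions**: for `g ≥ 0`,
`∑_{(B,C) ∈ T², B ∪ C functional} g(B ∪ C) ≤ ∑_{D ∈ T_{R²}} 4^{|D|} g(D)`. [folklore] -/
theorem sum_pairs_le_sum_unions (T : Finset (Finset (ℕ × Fin k))) (hT : T ⊆ tuplesProd k D₀ Rn)
    (g : Finset (ℕ × Fin k) → ℝ) (hg : ∀ D, 0 ≤ g D) :
    ∑ B ∈ T, ∑ C ∈ T, (if IsFunctional (B ∪ C) then g (B ∪ C) else 0) ≤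
      ∑ D ∈ tuplesProd k D₀ (Rn * Rn), (4:ℝ) ^ D.card * g D := by
  classical
  rw [← Finset.sum_product']
  have step1 : ∑ P ∈ T ×ˢ T, (if IsFunctional (P.1 ∪ P.2) then g (P.1 ∪ P.2) else 0) =
      ∑ P ∈ (T ×ˢ T).filter (fun P => IsFunctional (P.1 ∪ P.2)), g (P.1 ∪ P.2) := by
    rw [Finset.sum_filter]
  rw [step1]
  have hmaps : ∀ P ∈ (T ×ˢ T).filter (fun P => IsFunctional (P.1 ∪ P.2)), P.1 ∪ P.2 ∈ tuplesProd k D₀ (Rn * Rn) := by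
    intro P hP
    obtain ⟨hP, hf⟩ := Finset.mem_filter.1 hP
    obtain ⟨h1, h2⟩ := Finset.mem_product.1 hP
    exact union_mem_tuplesProd_sq (hT h1) (hT h2) hf
  rw [← Finset.sum_fiberwise_of_maps_to hmaps]
  refine Finset.sum_le_sum fun D _ => ?_
  rw [Finset.sum_congr rfl fun P hP => show g (P.1 ∪ P.2) = g D by rw [(Finset.mem_filter.1 hP).2], Finset.sum_const,
    nsmul_eq_mul]
  refine mul_le_mul_of_nonneg_right ?_ (hg D)
  calc ((((T ×ˢ T).filter (fun P => IsFunctional (P.1 ∪ P.2))).filter (fun P => P.1 ∪ P.2 = D)).card : ℝ)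
      ≤ ((D.powerset ×ˢ D.powerset).card : ℝ) := by
        exact_mod_cast Finset.card_le_card fun P hP => by
          obtain ⟨_, hPD⟩ := Finset.mem_filter.1 hP
          rw [Finset.mem_product, Finset.mem_powerset, Finset.mem_powerset, ← hPD]
          exact ⟨Finset.subset_union_left, Finset.subset_union_right⟩
    _ = (4:ℝ) ^ D.card := by
        rw [Finset.card_product, Finset.card_powerset]; push_cast; rw [← mul_pow]; norm_num

/-- The modulus `∏_{p ∈ fst D} p` of a divisor tuple. [folklore] -/
def qOf (D : Finset (ℕ × Fin k)) : ℕ := ∏ p ∈ D.image Prod.fst, p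

/-- `q_D ≥ 1` when the first coordinates are primes. [folklore] -/
theorem qOf_pos {D : Finset (ℕ × Fin k)} (hp : ∀ x ∈ D, x.1.Prime) : 0 < qOf D :=
  Finset.prod_pos fun p hp' => by obtain ⟨x, hx, rfl⟩ := Finset.mem_image.1 hp'; exact (hp x hx).pos

/-- The prime factors of `q_D` are the primes of `D`. [folklore] -/
theorem primeFactors_qOf {D : Finset (ℕ × Fin k)} (hp : ∀ x ∈ D, x.1.Prime) : (qOf D).primeFactors = D.image Prod.fst := by
  rw [qOf]
  exact Nat.primeFactors_prod fun p hp' => by obtain ⟨x, hx, rfl⟩ := Finset.mem_image.1 hp'; exact hp x hx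

/-- `q_D ≤ R'` for a divisor tuple `D` of level `R'`. [folklore] -/
theorem qOf_le {Rn' : ℕ} {D : Finset (ℕ × Fin k)} (hD : D ∈ tuplesProd k D₀ Rn') : qOf D ≤ Rn' := by
  have hf := isFunctional_of_mem_tuples (tuplesProd_subset hD)
  have : qOf D = ∏ x ∈ D, x.1 := by
    rw [qOf, Finset.prod_image]
    exact fun x hx y hy hxy => hf x hx y hy hxy
  rw [this]
  exact (mem_tuplesProd_iff.1 hD).2.2

/-- Divisor tuples with the same modulus have the same prime set; their number with weights `4^{|D'|}`
is at most `8^{k|D|}`. [folklore] -/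
theorem sum_filter_qOf_eq_le {Rn' : ℕ} {D : Finset (ℕ × Fin k)} (hD : D ∈ tuplesProd k D₀ Rn') :
    ∑ D' ∈ (tuplesProd k D₀ Rn').filter (fun D' => qOf D' = qOf D), (4:ℝ) ^ D'.card ≤ (8:ℝ) ^ (k * D.card) := by
  set V := D.image Prod.fst with hV
  have hpD : ∀ x ∈ D, x.1.Prime := fun x hx => prime_of_mem_tuples (tuplesProd_subset hD) hx
  have hfD := isFunctional_of_mem_tuples (tuplesProd_subset hD)
  have hVcard : V.card = D.card := (card_eq_card_image_fst hfD).symm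
  have hsub : (tuplesProd k D₀ Rn').filter (fun D' => qOf D' = qOf D) ⊆ (V ×ˢ (Finset.univ : Finset (Fin k))).powerset := by
    intro D' hD'
    obtain ⟨hD'T, hq⟩ := Finset.mem_filter.1 hD'
    have hpD' : ∀ x ∈ D', x.1.Prime := fun x hx => prime_of_mem_tuples (tuplesProd_subset hD'T) hx
    have himg : D'.image Prod.fst = V := by rw [hV, ← primeFactors_qOf hpD', hq, primeFactors_qOf hpD]
    rw [Finset.mem_powerset]
    intro x hx
    exact Finset.mem_product.2 ⟨himg ▸ Finset.mem_image_of_mem _ hx, Finset.mem_univ _⟩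
  have hcardle : ∀ D' ∈ (tuplesProd k D₀ Rn').filter (fun D' => qOf D' = qOf D), D'.card ≤ k * D.card := by
    intro D' hD'
    have := Finset.card_le_card (Finset.mem_powerset.1 (hsub hD'))
    rw [Finset.card_product, Finset.card_univ, Fintype.card_fin, hVcard] at this
    rw [Nat.mul_comm]; exact this
  calc ∑ D' ∈ (tuplesProd k D₀ Rn').filter (fun D' => qOf D' = qOf D), (4:ℝ) ^ D'.card
      ≤ ∑ D' ∈ (tuplesProd k D₀ Rn').filter (fun D' => qOf D' = qOf D), (4:ℝ) ^ (k * D.card) :=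
        Finset.sum_le_sum fun D' hD' => pow_le_pow_right₀ (by norm_num) (hcardle D' hD')
    _ = (((tuplesProd k D₀ Rn').filter (fun D' => qOf D' = qOf D)).card : ℝ) * (4:ℝ) ^ (k * D.card) := by
        rw [Finset.sum_const, nsmul_eq_mul]
    _ ≤ (2:ℝ) ^ (k * D.card) * (4:ℝ) ^ (k * D.card) := by
        gcongr
        have := Finset.card_le_card hsub
        rw [Finset.card_powerset, Finset.card_product, Finset.card_univ, Fintype.card_fin, hVcard, Nat.mul_comm] at this
        exact_mod_cast this
    _ = (8:ℝ) ^ (k * D.card) := by rw [← mul_pow]; norm_num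

/-- **The threshold trick** (in place of Maynard's Cauchy–Schwarz in the proof of Lemma 5.2, "By
Cauchy–Schwarz, the trivial bound `E(N, q) ≪ N/φ(q)`, and our hypothesis that the primes have level of
distribution `θ`"):
for weights `c_D = 4^{|D|}`, a nonnegative `g(q)` with a "trivial bound" `g(q_D) ≤ gtriv(D)`, and a
threshold `T > 0`,
`∑_D c_D g(q_D) ≤ T ∑_{q ∈ moduli} g(q) + T⁻¹ ∑_D c_D 8^{k|D|} gtriv(D)`. [cite: MaynardAnnals2015, proof of Lemma 5.2 (treatment of the error terms)] -/
theorem sum_le_threshold {Rn' : ℕ} (g : ℕ → ℝ) (hg : ∀ q, 0 ≤ g q) (gtriv : Finset (ℕ × Fin k) → ℝ)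
    (hgt : ∀ D ∈ tuplesProd k D₀ Rn', g (qOf D) ≤ gtriv D) {T : ℝ} (hT : 0 < T) :
    ∑ D ∈ tuplesProd k D₀ Rn', (4:ℝ) ^ D.card * g (qOf D) ≤
      T * ∑ q ∈ (tuplesProd k D₀ Rn').image qOf, g q +
        T⁻¹ * ∑ D ∈ tuplesProd k D₀ Rn', (4:ℝ) ^ D.card * (8:ℝ) ^ (k * D.card) * gtriv D := by
  classical
  set TP := tuplesProd k D₀ Rn' with hTP
  set μ : Finset (ℕ × Fin k) → ℝ := fun D => ∑ D' ∈ TP.filter (fun D' => qOf D' = qOf D), (4:ℝ) ^ D'.card with hμ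
  have hgt0 : ∀ D ∈ TP, 0 ≤ gtriv D := fun D hD => (hg _).trans (hgt D hD)
  rw [← Finset.sum_filter_add_sum_filter_not TP (fun D => μ D ≤ T)]
  refine add_le_add ?_ ?_
  · have hmaps : ∀ D ∈ TP.filter (fun D => μ D ≤ T), qOf D ∈ TP.image qOf :=
      fun D hD => Finset.mem_image_of_mem _ (Finset.mem_filter.1 hD).1
    rw [← Finset.sum_fiberwise_of_maps_to hmaps, Finset.mul_sum]
    refine Finset.sum_le_sum fun q hq => ?_
    rw [Finset.sum_congr rfl fun D hD => show (4:ℝ) ^ D.card * g (qOf D) = (4:ℝ) ^ D.card * g q by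
      rw [(Finset.mem_filter.1 hD).2], ← Finset.sum_mul, mul_comm]
    rw [mul_comm T]
    refine mul_le_mul_of_nonneg_left ?_ (hg q)
    by_cases hne : ((TP.filter (fun D => μ D ≤ T)).filter (fun D => qOf D = q)).Nonempty
    · obtain ⟨D₁, hD₁⟩ := hne
      obtain ⟨hD₁', hq₁⟩ := Finset.mem_filter.1 hD₁
      obtain ⟨hD₁T, hμ₁⟩ := Finset.mem_filter.1 hD₁'
      refine le_trans ?_ hμ₁
      refine Finset.sum_le_sum_of_subset_of_nonneg (fun D hD => ?_) fun D _ _ => by positivity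
      obtain ⟨hD', hq'⟩ := Finset.mem_filter.1 hD
      exact Finset.mem_filter.2 ⟨(Finset.mem_filter.1 hD').1, by rw [hq', hq₁]⟩
    · rw [Finset.not_nonempty_iff_eq_empty] at hne
      rw [hne, Finset.sum_empty]; exact hT.le
  · rw [Finset.mul_sum]
    calc ∑ D ∈ TP.filter (fun D => ¬μ D ≤ T), (4:ℝ) ^ D.card * g (qOf D)
        ≤ ∑ D ∈ TP.filter (fun D => ¬μ D ≤ T), T⁻¹ * ((4:ℝ) ^ D.card * (8:ℝ) ^ (k * D.card) * gtriv D) := by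
          refine Finset.sum_le_sum fun D hD => ?_
          obtain ⟨hDT, hμD⟩ := Finset.mem_filter.1 hD
          push Not at hμD
          have hμle : μ D ≤ (8:ℝ) ^ (k * D.card) := sum_filter_qOf_eq_le hDT
          have h1 : 1 ≤ T⁻¹ * (8:ℝ) ^ (k * D.card) := by
            rw [le_inv_mul_iff₀ hT, mul_one]; exact hμD.le.trans hμle
          calc (4:ℝ) ^ D.card * g (qOf D) ≤ (4:ℝ) ^ D.card * gtriv D * 1 := by
                rw [mul_one]; exact mul_le_mul_of_nonneg_left (hgt D hDT) (by positivity)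
            _ ≤ (4:ℝ) ^ D.card * gtriv D * (T⁻¹ * (8:ℝ) ^ (k * D.card)) :=
                mul_le_mul_of_nonneg_left h1 (mul_nonneg (by positivity) (hgt0 D hDT))
            _ = _ := by ring
      _ ≤ ∑ D ∈ TP, T⁻¹ * ((4:ℝ) ^ D.card * (8:ℝ) ^ (k * D.card) * gtriv D) :=
          Finset.sum_le_sum_of_subset_of_nonneg (Finset.filter_subset _ _) fun D hD _ =>
            mul_nonneg (inv_nonneg.2 hT.le) (mul_nonneg (by positivity) (hgt0 D hD))

/-- The weighted trivial-bound sum in product form: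
`∑_D 4^{|D|} 8^{k|D|} / ∏_{p ∈ D}(p−1) ≤ M_w^k`, `w(p) = 4·8^k/(p − 1)`. [folklore] -/
theorem sum_weights_div_le_pow {Rn' : ℕ} :
    ∑ D ∈ tuplesProd k D₀ Rn', (4:ℝ) ^ D.card * (8:ℝ) ^ (k * D.card) * (1 / ∏ x ∈ D, ((x.1 : ℝ) - 1)) ≤
      (∑ v ∈ goodNat D₀ Rn', sfw (primorial D₀) (fun p => 4 * 8 ^ k / ((p : ℝ) - 1)) v) ^ k := by
  set w : ℕ → ℝ := fun p => 4 * 8 ^ k / ((p : ℝ) - 1) with hw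
  have hw0 : ∀ p, p.Prime → 0 ≤ w p := fun p hp => by
    have : (2:ℝ) ≤ p := by exact_mod_cast hp.two_le
    simp only [hw]; apply div_nonneg (by positivity); linarith
  have hterm : ∀ D ∈ tuples k D₀ Rn', (4:ℝ) ^ D.card * (8:ℝ) ^ (k * D.card) * (1 / ∏ x ∈ D, ((x.1 : ℝ) - 1)) =
      ∏ i, sfw (primorial D₀) w (rad D i) := by
    intro D hD
    simp_rw [sfw_rad w hD]
    rw [Finset.prod_fiberwise D Prod.snd (fun x => w x.1)]
    simp only [hw]
    rw [Finset.prod_div_distrib, Finset.prod_const, pow_mul, ← mul_pow, one_div, div_eq_mul_inv]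
  calc _ ≤ ∑ D ∈ tuples k D₀ Rn', (4:ℝ) ^ D.card * (8:ℝ) ^ (k * D.card) * (1 / ∏ x ∈ D, ((x.1 : ℝ) - 1)) := by
        refine Finset.sum_le_sum_of_subset_of_nonneg tuplesProd_subset fun D hD _ => ?_
        refine mul_nonneg (by positivity) (one_div_nonneg.2 (Finset.prod_nonneg fun x hx => ?_))
        have : (2:ℝ) ≤ x.1 := by exact_mod_cast (prime_of_mem_tuples hD hx).two_le
        linarith
    _ = ∑ D ∈ tuples k D₀ Rn', ∏ i, sfw (primorial D₀) w (rad D i) := Finset.sum_congr rfl hterm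
    _ ≤ ∏ _i : Fin k, ∑ v ∈ goodNat D₀ Rn', sfw (primorial D₀) w v :=
        sum_tuples_prod_le (fun _ => sfw (primorial D₀) w) fun i u _ => sfw_nonneg hw0 u
    _ = _ := by rw [Finset.prod_const, Finset.card_univ, Fintype.card_fin]

end PairSum

/-! ### Trivial bounds, Mertens-type products, and the assembled error estimate -/

section Trivial

variable {D₀ Rn : ℕ}

/-- An arithmetic progression count: `#{j ≤ n : j ≡ a (M)} ≤ (n+1)/M + 1`. [folklore] -/
theorem card_filter_range_modEq_le {M : ℕ} (hM : 0 < M) (a n : ℕ) :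
    (((Finset.range (n + 1)).filter (fun j => j ≡ a [MOD M])).card : ℝ) ≤ ((n : ℝ) + 1) / M + 1 := by
  have hinj : ((Finset.range (n + 1)).filter (fun j => j ≡ a [MOD M])).card ≤
      ((Finset.Ico (0 : ℤ) ((n : ℤ) + 1)).filter (fun j => j ≡ (a : ℤ) [ZMOD (M : ℤ)])).card := by
    refine Finset.card_le_card_of_injOn (fun j : ℕ => (j : ℤ)) (fun j hj => ?_) (fun j _ j' _ h => by simpa using h)
    rw [Finset.mem_coe, Finset.mem_filter, Finset.mem_range] at hj
    rw [Finset.mem_coe, Finset.mem_filter, Finset.mem_Ico]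
    dsimp only
    refine ⟨⟨Int.natCast_nonneg j, by have := hj.1; omega⟩, (Int.natCast_modEq_iff).2 hj.2⟩
  have key := abs_card_filter_modEq_sub_le (0 : ℤ) ((n : ℤ) + 1) (a : ℤ) (by omega) (r := (M : ℤ)) (by exact_mod_cast hM)
  have h2 := (abs_le.1 key).2
  have e : ((((n : ℤ) + 1 : ℤ) : ℝ) - ((0 : ℤ) : ℝ)) / ((M : ℤ) : ℝ) = ((n : ℝ) + 1) / M := by push_cast; ring
  rw [e] at h2
  have h3 : (((Finset.range (n + 1)).filter (fun j => j ≡ a [MOD M])).card : ℝ) ≤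
      ((Finset.Ico (0 : ℤ) ((n : ℤ) + 1)).filter (fun j => j ≡ (a : ℤ) [ZMOD (M : ℤ)])).card := by exact_mod_cast hinj
  linarith

/-- **Trivial bound for the discrepancy**: `Δ_π(x; M) ≤ 3x/φ(M) + 1`. [folklore] -/
theorem piDisc_le_trivial {M : ℕ} (hM : 0 < M) {x : ℝ} (hx : 1 ≤ x) : piDisc x M ≤ 3 * x / M.totient + 1 := by
  have hφpos : (0:ℝ) < M.totient := by exact_mod_cast Nat.totient_pos.2 hM
  have hφle : (M.totient : ℝ) ≤ M := by exact_mod_cast Nat.totient_le M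
  have hM' : (0:ℝ) < M := by exact_mod_cast hM
  rw [piDisc]
  refine Real.iSup_le (fun y => Real.iSup_le (fun a => ?_) (by positivity)) (by positivity)
  have hy1 : (1:ℝ) ≤ y := y.2.1
  have hyx : (y : ℝ) ≤ x := y.2.2
  set n := ⌊(y : ℝ)⌋₊ with hn
  have hnx : (n : ℝ) ≤ x := (Nat.floor_le (by linarith)).trans hyx
  have h1 : (LevelOfDistribution.primeCountingMod M (a : ZMod M).val n : ℝ) ≤ 2 * x / M.totient + 1 := by
    have hle : LevelOfDistribution.primeCountingMod M (a : ZMod M).val n ≤ ((Finset.range (n + 1)).filter (fun j => j ≡ (a : ZMod M).val [MOD M])).card :=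
      Finset.card_le_card (fun p hp => by
        rw [Finset.mem_filter] at hp ⊢; exact ⟨hp.1, hp.2.2⟩)
    calc (LevelOfDistribution.primeCountingMod M (a : ZMod M).val n : ℝ) ≤ ((n : ℝ) + 1) / M + 1 :=
          (by exact_mod_cast hle : (LevelOfDistribution.primeCountingMod M (a : ZMod M).val n : ℝ) ≤ _).trans (card_filter_range_modEq_le hM _ n)
      _ ≤ 2 * x / M + 1 := by gcongr; linarith
      _ ≤ 2 * x / M.totient + 1 := by gcongr
  have h2 : (Nat.primeCounting n : ℝ) / M.totient ≤ x / M.totient := by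
    gcongr
    exact (cast_primeCounting_le_self n).trans hnx
  have h0a : 0 ≤ (LevelOfDistribution.primeCountingMod M (a : ZMod M).val n : ℝ) := Nat.cast_nonneg _
  have h0b : 0 ≤ (Nat.primeCounting n : ℝ) / M.totient := by positivity
  have hx0 : 0 ≤ x / M.totient := by positivity
  have e3 : 3 * x / M.totient = 3 * (x / M.totient) := by ring
  have e2 : 2 * x / M.totient = 2 * (x / M.totient) := by ring
  rw [e3]; rw [e2] at h1
  rw [abs_le]; constructor <;> linarith

/-- **Squarefree weighted sums are dominated by Euler products**:
`∑_{v good ≤ Y} sfw_w(v) ≤ ∏_{D₀ < p ≤ Y} (1 + w(p))`. [folklore] -/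
theorem sum_goodNat_sfw_le_prod {Y : ℕ} {w : ℕ → ℝ} (hw : ∀ p, p.Prime → 0 ≤ w p) :
    ∑ v ∈ goodNat D₀ Y, sfw (primorial D₀) w v ≤ ∏ p ∈ primesIoc D₀ Y, (1 + w p) := by
  rw [Finset.prod_one_add]
  have hterm : ∀ v ∈ goodNat D₀ Y, sfw (primorial D₀) w v = ∏ p ∈ v.primeFactors, w p := by
    intro v hv
    obtain ⟨h1, hsq, hco⟩ := mem_goodNat_iff.1 hv
    exact sfw_apply_of w (by have := (Finset.mem_Icc.1 h1).1; omega) hsq hco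
  rw [Finset.sum_congr rfl hterm]
  have hinj : Set.InjOn (fun v : ℕ => v.primeFactors) (goodNat D₀ Y : Set ℕ) := by
    intro v hv v' hv' h
    obtain ⟨_, hsq, _⟩ := mem_goodNat_iff.1 hv
    obtain ⟨_, hsq', _⟩ := mem_goodNat_iff.1 hv'
    simp only at h
    rw [← Nat.prod_primeFactors_of_squarefree hsq, ← Nat.prod_primeFactors_of_squarefree hsq', h]
  rw [← Finset.sum_image (f := fun S => ∏ p ∈ S, w p) hinj]
  refine Finset.sum_le_sum_of_subset_of_nonneg (fun S hS => ?_) fun S hS _ => ?_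
  · obtain ⟨v, hv, rfl⟩ := Finset.mem_image.1 hS
    obtain ⟨h1, hsq, hco⟩ := mem_goodNat_iff.1 hv
    have hv0 : v ≠ 0 := by have := (Finset.mem_Icc.1 h1).1; omega
    rw [Finset.mem_powerset]
    intro p hp
    have hpp := Nat.prime_of_mem_primeFactors hp
    rw [mem_primesIoc]
    exact ⟨⟨(coprime_primorial_iff hv0).1 hco p hp, (Nat.le_of_mem_primeFactors hp).trans (Finset.mem_Icc.1 h1).2⟩, hpp⟩
  · exact Finset.prod_nonneg fun p hp => hw p (mem_primesIoc.1 (Finset.mem_powerset.1 hS hp)).2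

/-- `∑_{D₀ < p ≤ Y} C/(p − 1) ≤ 2C ∑_{p ≤ Y} 1/p`. [folklore] -/
theorem sum_primesIoc_div_sub_one_le {Y : ℕ} {C : ℝ} (hC : 0 ≤ C) :
    ∑ p ∈ primesIoc D₀ Y, C / ((p : ℝ) - 1) ≤ 2 * C * ∑ p ∈ Nat.primesLE Y, (1 : ℝ) / p := by
  rw [Finset.mul_sum]
  calc ∑ p ∈ primesIoc D₀ Y, C / ((p : ℝ) - 1) ≤ ∑ p ∈ primesIoc D₀ Y, 2 * C * (1 / (p : ℝ)) := by
        refine Finset.sum_le_sum fun p hp => ?_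
        have hpp := (mem_primesIoc.1 hp).2
        have h2 : (2:ℝ) ≤ p := by exact_mod_cast hpp.two_le
        rw [div_le_iff₀ (by linarith), show 2 * C * (1 / (p : ℝ)) * ((p : ℝ) - 1) = C * (2 * ((p : ℝ) - 1) / p) by
          field_simp]
        refine le_mul_of_one_le_right hC ?_
        rw [le_div_iff₀ (by linarith)]; linarith
    _ ≤ ∑ p ∈ Nat.primesLE Y, 2 * C * (1 / (p : ℝ)) := by
        refine Finset.sum_le_sum_of_subset_of_nonneg (fun p hp => ?_) fun p _ _ => by positivity
        rw [mem_primesIoc] at hp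
        exact Nat.mem_primesLE.2 ⟨hp.1.2, hp.2⟩

/-- **Mertens-type bound for the weighted masses**: with the constants `B, C₀` of
`Literature.NumberTheory.Sieve.mertens_sum_inv_primes`, for `Y ≥ 2` and `w(p) = C/(p−1)`,
`∑_{v good ≤ Y} sfw_w(v) ≤ exp(2C(log log Y + B + C₀/log Y))`. [cite: AletheiaZomleferFukshanskyGarcia2020, §5.3 Theorem 5.3.2] -/
theorem sum_goodNat_sfw_le_exp {Y : ℕ} (hY : 2 ≤ Y) {C B C₀ : ℝ} (hC : 0 ≤ C)
    (hM : ∀ x : ℝ, 2 ≤ x → |∑ p ∈ Nat.primesLE ⌊x⌋₊, (1 : ℝ) / p - Real.log (Real.log x) - B| ≤ C₀ / Real.log x) :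
    ∑ v ∈ goodNat D₀ Y, sfw (primorial D₀) (fun p => C / ((p : ℝ) - 1)) v ≤
      Real.exp (2 * C * (Real.log (Real.log Y) + B + C₀ / Real.log Y)) := by
  have hw : ∀ p : ℕ, p.Prime → 0 ≤ C / ((p : ℝ) - 1) := fun p hp => by
    have : (2:ℝ) ≤ p := by exact_mod_cast hp.two_le
    exact div_nonneg hC (by linarith)
  refine (sum_goodNat_sfw_le_prod hw).trans
    ((Literature.NumberTheory.Sieve.SquarefreeSums.prod_one_add_le_exp_sum fun p hp => hw p (mem_primesIoc.1 hp).2).trans ?_)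
  rw [Real.exp_le_exp]
  refine (sum_primesIoc_div_sub_one_le hC).trans ?_
  refine mul_le_mul_of_nonneg_left ?_ (by positivity : (0:ℝ) ≤ 2 * C)
  have := hM Y (by exact_mod_cast hY)
  rw [Nat.floor_natCast (R := ℝ)] at this
  have := (abs_le.1 this).2
  linarith

/-- Reindexing the moduli `q ↦ Wq`: `∑_{q ∈ moduli} Δ(x; Wq) ≤ ∑_{q' ≤ Q} Δ(x; q')` for `W R' ≤ Q`.
[folklore] -/
theorem sum_image_qOf_le {Rn' : ℕ} {x : ℝ} {Q : ℕ} (hQ : primorial D₀ * Rn' ≤ Q) :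
    ∑ q ∈ (tuplesProd k D₀ Rn').image qOf, piDisc x (primorial D₀ * q) ≤ ∑ q' ∈ Finset.Icc 1 Q, piDisc x q' := by
  have hW := primorial_pos D₀
  rw [← Finset.sum_image (f := fun q' => piDisc x q') (g := fun q => primorial D₀ * q)
    (fun q _ q' _ h => Nat.eq_of_mul_eq_mul_left hW h)]
  refine Finset.sum_le_sum_of_subset_of_nonneg (fun q' hq' => ?_) fun q' _ _ => piDisc_nonneg _ _
  obtain ⟨q, hq, rfl⟩ := Finset.mem_image.1 hq'
  obtain ⟨D, hD, rfl⟩ := Finset.mem_image.1 hq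
  rw [Finset.mem_Icc]
  have hq1 : 1 ≤ qOf D := qOf_pos fun y hy => prime_of_mem_tuples (tuplesProd_subset hD) hy
  exact ⟨le_trans hW (Nat.le_mul_of_pos_right _ hq1), (Nat.mul_le_mul_left _ (qOf_le hD)).trans hQ⟩

end Trivial

/-! ### The assembled estimate for the error terms of `S₂^{(m)}` -/

section Assembled

variable {D₀ Rn N : ℕ} {v₀ : ℤ} {h : Fin k → ℤ}

/-- **The error terms of Lemma 5.2, assembled** (Maynard 2015, end of the proof of Lemma 5.2): for
`y` bounded by `Y` on the support tuples, `N + h_m ≥ 2`, `x ≥ 2N + h_m − 1`, `x ≥ 1`, `W R² ≤ Q`, and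
any threshold `T > 0`,
`|∑'_{d,e} λ_d λ_e E(d,e)| ≤ (Y M₁^{2k})² · 2 · (T ∑_{q ≤ Q} Δ_π(x; q) + T⁻¹ (3x + R²) M_w^k)`,
`M₁ = ∑_{v good ≤ R} sfw₁(v)`, `M_w = ∑_{v good ≤ R²} sfw_w(v)`, `w(p) = 4·8^k/(p−1)`.
[cite: MaynardAnnals2015, proof of Lemma 5.2 (treatment of the error terms: τ_{3k}(r) choices of d, e with the same modulus r, the trivial bound, and the level of distribution)] -/
theorem abs_pairErr_le (hh : ShiftHyp k D₀ h) (hv₀ : ∀ i, Int.gcd (v₀ + h i) (primorial D₀) = 1) (m : Fin k)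
    {y : Finset (ℕ × Fin k) → ℝ} {Y : ℝ} (hY0 : 0 ≤ Y) (hY : ∀ A ∈ tuplesProd k D₀ Rn, |y A| ≤ Y)
    (hN : 2 ≤ (N : ℤ) + h m) {x : ℝ} (hx : (((2 * N : ℤ) + h m - 1 : ℤ) : ℝ) ≤ x) (hx1 : 1 ≤ x)
    {Q : ℕ} (hQ : primorial D₀ * (Rn * Rn) ≤ Q) {T : ℝ} (hT : 0 < T) :
    |∑ B ∈ tuplesOff k D₀ Rn m, ∑ C ∈ tuplesOff k D₀ Rn m,
        (if IsFunctional (B ∪ C) then lam D₀ Rn y B * lam D₀ Rn y C *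
          err2 D₀ N v₀ h m ((Nat.primeCounting ((2 * N : ℤ) + h m - 1).toNat : ℝ) -
            Nat.primeCounting (((N : ℤ) + h m - 1).toNat)) B C else 0)| ≤
      (Y * (∑ v ∈ goodNat D₀ Rn, sfw (primorial D₀) wOne v) ^ (2 * k)) ^ 2 * 2 *
        (T * ∑ q' ∈ Finset.Icc 1 Q, piDisc x q' +
          T⁻¹ * ((3 * x + Rn * Rn) *
            (∑ v ∈ goodNat D₀ (Rn * Rn), sfw (primorial D₀) (fun p => 4 * 8 ^ k / ((p : ℝ) - 1)) v) ^ k)) := by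
  set W := primorial D₀ with hW
  set Λ := Y * (∑ v ∈ goodNat D₀ Rn, sfw W wOne v) ^ (2 * k) with hΛ
  set X : ℝ := (Nat.primeCounting ((2 * N : ℤ) + h m - 1).toNat : ℝ) - Nat.primeCounting (((N : ℤ) + h m - 1).toNat) with hX
  set Tm := tuplesOff k D₀ Rn m with hTm
  have hΛ0 : 0 ≤ Λ := mul_nonneg hY0 (pow_nonneg (Finset.sum_nonneg fun v _ => sfw_nonneg (fun p hp => wOne_nonneg hp) v) _)
  have hlam : ∀ B, |lam D₀ Rn y B| ≤ Λ := fun B => abs_lam_le_pow hY0 hY B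
  have hTmsub : Tm ⊆ tuplesProd k D₀ Rn := Finset.filter_subset _ _
  -- Step 1: pull out `Λ²` and the pointwise bound `|err2| ≤ 2 piDisc`
  set g : Finset (ℕ × Fin k) → ℝ := fun D => 2 * piDisc x (W * qOf D) with hg
  have hg0 : ∀ D, 0 ≤ g D := fun D => by simp only [hg]; exact mul_nonneg zero_le_two (piDisc_nonneg _ _)
  have step1 : |∑ B ∈ Tm, ∑ C ∈ Tm, (if IsFunctional (B ∪ C) then lam D₀ Rn y B * lam D₀ Rn y C * err2 D₀ N v₀ h m X B C else 0)| ≤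
      Λ ^ 2 * ∑ B ∈ Tm, ∑ C ∈ Tm, (if IsFunctional (B ∪ C) then g (B ∪ C) else 0) := by
    rw [Finset.mul_sum]
    refine (Finset.abs_sum_le_sum_abs _ _).trans (Finset.sum_le_sum fun B hB => ?_)
    rw [Finset.mul_sum]
    refine (Finset.abs_sum_le_sum_abs _ _).trans (Finset.sum_le_sum fun C hC => ?_)
    split_ifs with hf
    · rw [abs_mul, abs_mul]
      have he := abs_err2_le hh hv₀ m hB hC hf hN hx
      calc |lam D₀ Rn y B| * |lam D₀ Rn y C| * |err2 D₀ N v₀ h m X B C| ≤ Λ * Λ * (2 * piDisc x (W * qOf (B ∪ C))) := by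
            refine mul_le_mul (mul_le_mul (hlam B) (hlam C) (abs_nonneg _) hΛ0) he (abs_nonneg _) (by positivity)
        _ = Λ ^ 2 * g (B ∪ C) := by simp only [hg]; ring
    · rw [abs_zero, mul_zero]
  -- Step 2: pairs → unions → threshold
  have step2 := sum_pairs_le_sum_unions Tm hTmsub g hg0
  set gt : Finset (ℕ × Fin k) → ℝ := fun D => 2 * ((3 * x / W.totient + Rn * Rn) * (1 / ∏ y' ∈ D, ((y'.1 : ℝ) - 1))) with hgt
  have hφW : (0:ℝ) < W.totient := by exact_mod_cast Nat.totient_pos.2 (primorial_pos D₀)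
  have hgt_ok : ∀ D ∈ tuplesProd k D₀ (Rn * Rn), (fun q => 2 * piDisc x (W * q)) (qOf D) ≤ gt D := by
    intro D hD
    have hpD : ∀ y' ∈ D, y'.1.Prime := fun y' hy' => prime_of_mem_tuples (tuplesProd_subset hD) hy'
    have hfD := isFunctional_of_mem_tuples (tuplesProd_subset hD)
    have hUW : ∀ p ∈ D.image Prod.fst, ¬p ∣ W := fun p hp => by
      obtain ⟨y', hy', rfl⟩ := Finset.mem_image.1 hp
      rw [hW, (hpD y' hy').dvd_primorial_iff]
      have := lt_of_mem_tuples (tuplesProd_subset hD) hy'; omega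
    have hq0 : 0 < W * qOf D := Nat.mul_pos (primorial_pos D₀) (qOf_pos hpD)
    have htriv := piDisc_le_trivial hq0 hx1
    have hφ : ((W * qOf D).totient : ℝ) = W.totient * ∏ y' ∈ D, ((y'.1 : ℝ) - 1) := by
      rw [qOf, totient_mul_prod_primes W _ (fun p hp => by obtain ⟨y', hy', rfl⟩ := Finset.mem_image.1 hp; exact hpD y' hy') hUW,
        ← prod_eq_prod_image_fst hfD (fun p => (p : ℝ) - 1)]
    have hP0 : 0 < ∏ y' ∈ D, ((y'.1 : ℝ) - 1) := Finset.prod_pos fun y' hy' => by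
      have : (2:ℝ) ≤ y'.1 := by exact_mod_cast (hpD y' hy').two_le
      linarith
    -- `1 ≤ R² / ∏(p-1)` since `∏(p−1) ≤ ∏ p = q ≤ R²`
    have hone : (1:ℝ) ≤ Rn * Rn * (1 / ∏ y' ∈ D, ((y'.1 : ℝ) - 1)) := by
      rw [mul_one_div, le_div_iff₀ hP0, one_mul]
      have h1 : ∏ y' ∈ D, ((y'.1 : ℝ) - 1) ≤ ∏ y' ∈ D, (y'.1 : ℝ) := by
        refine Finset.prod_le_prod (fun y' hy' => ?_) fun y' _ => by linarith
        have : (2:ℝ) ≤ y'.1 := by exact_mod_cast (hpD y' hy').two_le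
        linarith
      have h2 : ∏ y' ∈ D, (y'.1 : ℝ) ≤ Rn * Rn := by
        have := (mem_tuplesProd_iff.1 hD).2.2; exact_mod_cast this
      linarith
    simp only [hgt]
    refine mul_le_mul_of_nonneg_left (htriv.trans ?_) zero_le_two
    rw [hφ, add_mul]
    refine add_le_add (le_of_eq ?_) hone
    field_simp
  have step3 := sum_le_threshold (D₀ := D₀) (Rn' := Rn * Rn) (fun q => 2 * piDisc x (W * q))
    (fun q => mul_nonneg zero_le_two (piDisc_nonneg _ _)) gt hgt_ok hT
  -- Step 3: the two resulting sums
  have hmod := sum_image_qOf_le (k := k) (x := x) hQ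
  have hwsum := sum_weights_div_le_pow (k := k) (D₀ := D₀) (Rn' := Rn * Rn)
  set Mw := ∑ v ∈ goodNat D₀ (Rn * Rn), sfw W (fun p => 4 * 8 ^ k / ((p : ℝ) - 1)) v with hMw
  have htrivsum : ∑ D ∈ tuplesProd k D₀ (Rn * Rn), (4:ℝ) ^ D.card * (8:ℝ) ^ (k * D.card) * gt D ≤
      2 * ((3 * x + Rn * Rn) * Mw ^ k) := by
    have hφ1 : (1:ℝ) ≤ W.totient := by exact_mod_cast Nat.totient_pos.2 (primorial_pos D₀)
    calc _ = 2 * (3 * x / W.totient + Rn * Rn) * ∑ D ∈ tuplesProd k D₀ (Rn * Rn),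
          (4:ℝ) ^ D.card * (8:ℝ) ^ (k * D.card) * (1 / ∏ y' ∈ D, ((y'.1 : ℝ) - 1)) := by
          rw [Finset.mul_sum]; refine Finset.sum_congr rfl fun D _ => ?_; simp only [hgt]; ring
      _ ≤ 2 * (3 * x + Rn * Rn) * Mw ^ k := by
          refine mul_le_mul ?_ hwsum (Finset.sum_nonneg fun D hD => ?_) (by positivity)
          · refine mul_le_mul_of_nonneg_left (add_le_add (div_le_self (by positivity) hφ1) le_rfl) zero_le_two
          · refine mul_nonneg (by positivity) (one_div_nonneg.2 (Finset.prod_nonneg fun y' hy' => ?_))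
            have : (2:ℝ) ≤ y'.1 := by exact_mod_cast (prime_of_mem_tuples (tuplesProd_subset hD) hy').two_le
            linarith
      _ = _ := by ring
  calc _ ≤ Λ ^ 2 * ∑ B ∈ Tm, ∑ C ∈ Tm, (if IsFunctional (B ∪ C) then g (B ∪ C) else 0) := step1
    _ ≤ Λ ^ 2 * ∑ D ∈ tuplesProd k D₀ (Rn * Rn), (4:ℝ) ^ D.card * g D := mul_le_mul_of_nonneg_left step2 (sq_nonneg _)
    _ ≤ Λ ^ 2 * (T * ∑ q ∈ (tuplesProd k D₀ (Rn * Rn)).image qOf, 2 * piDisc x (W * q) +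
          T⁻¹ * ∑ D ∈ tuplesProd k D₀ (Rn * Rn), (4:ℝ) ^ D.card * (8:ℝ) ^ (k * D.card) * gt D) :=
        mul_le_mul_of_nonneg_left step3 (sq_nonneg _)
    _ ≤ Λ ^ 2 * (T * (2 * ∑ q' ∈ Finset.Icc 1 Q, piDisc x q') + T⁻¹ * (2 * ((3 * x + Rn * Rn) * Mw ^ k))) := by
        gcongr
        · rw [← Finset.mul_sum]; exact mul_le_mul_of_nonneg_left hmod zero_le_two
    _ = _ := by ring

end Assembled

end MaynardTao
end Literature.NumberTheory.Sieve
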